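import Literature.Probability.RandomPlanarGeometry.SAWPulledLargeForceExpansionZdSevenStep
import Literature.Probability.RandomPlanarGeometry.SAWPulledLargeForceExpansionZdHeights
import HarnessLib

/-!
# The pulled self-avoiding walk on `ℤ^{d+1}` at large force: the three-slack layer at span two
# (`N_{7,9} = 640d⁵ − 1088d⁴ + 320d³ + 376d² − 196d`)

Topic `Literature/Probability/RandomPlanarGeometry` (continues `SAWPulledLargeForceExpansionZdSevenStep.lean` /
`…ZdSixStep.lean` (`sixStepIndex`, the five-step transverse self-avoiding walks, `card_sixStepIndex_add`) and
`…ZdHeights.lean` (`no_up_down_of_mem_saws`, `no_down_up_of_mem_saws`, `not_irreducible_of_monotone`)).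

THE LAYER `N_{7,9}`. An irreducible bridge of `ℤ^{d+1}` of length nine and cost seven has span two; its heights after the start live
in `{1, 2}`, an up-step is never followed at once by a down-step (site revisit) nor a down-step by an up-step, and a monotone profile
is reducible. Hence the height word is `U T^a U T^b D T^c U T^e` with `a + b + c + e = 5`, `b ≥ 1`, `c ≥ 1` — twenty words, coded
below by the three vertical times `(p, q, r) = (a+1, a+b+2, a+b+c+3)` — and the bridge is the table-driven walk `walk v u` of its
five transverse steps `u`. Self-avoidance of `walk v u` is a block condition on `u` (sites of the same level coincide iff the
transverse steps between them sum to zero); the twenty fibres fall into five classes by the reflection `u ↦ u^{rev}`, counted by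
the five-step self-avoiding walks (`8` words), and four explicit relaxations (`4 + 4 + 2 + 2` words):
`N_{7,9} = 8·c₅ + 4·P_B + 4·P_C + 2·P_D + 2·P_E = 640d⁵ − 1088d⁴ + 320d³ + 376d² − 196d` (`d = 1, 2, 3`: `52`, `6 744`, `78 828`).
This is the `A = 2` instance of the lane's three-slack law (CONJECTURE (15) of FINDING-PULLED-LARGE-FORCE); not in print.

## Contents (namespace `Literature.Probability.RandomPlanarGeometry.SAW.Zd.ThreeSlackTwo`; all PROVED, standard axioms, no data)
`IsVert`, `ht`, `tau`, `psum5`, `walk`; generic `walk_adj/_isBridge/_not_renewal/_mem_filter/_injective`, `verts_eq_of_eq`;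
the converse ★ `exists_params_of_mem`; ★ `costCoeffZd_seven_nine_eq_sum` (the layer as a sum of twenty fibres); the fibres
(`adm`, `mem_adm_iff`), the five fibre counts, and ★★ `costCoeffZd_seven_nine`.
Provenance: lane «pcv-sawmu», a-p3 g18 (2026-08-25). [cite: MadrasSlade1993, §4.2, remark after Theorem 4.2.4 (p. 94)]
[cite: DuminilCopinHammond2013, §2.2]
-/

noncomputable section

open Finset
open scoped BigOperators
open Literature.Probability.LatticeModels
open Literature.Probability.RandomPlanarGeometry.SAW

namespace Literature.Probability.RandomPlanarGeometry.SAW.Zd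

namespace ThreeSlackTwo

/-! ### Vertical times, heights and the transverse clock -/

/-- Admissible vertical times `(p, q, r)` of a nine-step walk with height word `U T^a U T^b D T^c U T^e`, `b, c ≥ 1`:
the up-steps are at times `0, p, r`, the down-step at time `q`, `1 ≤ p`, `p + 2 ≤ q`, `q + 2 ≤ r ≤ 8`.
[cite: MadrasSlade1993, §4.2, remark after Theorem 4.2.4 (p. 94)] -/
def IsVert (v : ℕ × ℕ × ℕ) : Prop := 1 ≤ v.1 ∧ v.1 + 2 ≤ v.2.1 ∧ v.2.1 + 2 ≤ v.2.2 ∧ v.2.2 ≤ 8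

/-- `IsVert` is decidable. [cite: MadrasSlade1993, §4.2, remark after Theorem 4.2.4 (p. 94)] -/
instance : DecidablePred IsVert := fun v => by unfold IsVert; infer_instance

/-- The height at time `t`: `0, 1 (t ≤ p), 2 (t ≤ q), 1 (t ≤ r), 2`. [cite: MadrasSlade1993, §4.2, remark after Theorem 4.2.4 (p. 94)] -/
def ht (v : ℕ × ℕ × ℕ) (t : ℕ) : ℕ :=
  if t = 0 then 0 else if t ≤ v.1 then 1 else if t ≤ v.2.1 then 2 else if t ≤ v.2.2 then 1 else 2

/-- The number of transverse steps taken before time `t`. [cite: MadrasSlade1993, §4.2, remark after Theorem 4.2.4 (p. 94)] -/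
def tau (v : ℕ × ℕ × ℕ) (t : ℕ) : ℕ :=
  if t = 0 then 0 else if t ≤ v.1 then t - 1 else if t ≤ v.2.1 then t - 2 else if t ≤ v.2.2 then t - 3 else t - 4

/-- The vertical times (including the initial up-step at time `0`). [cite: MadrasSlade1993, §4.2, remark after Theorem 4.2.4 (p. 94)] -/
def IsVTime (v : ℕ × ℕ × ℕ) (t : ℕ) : Prop := t = 0 ∨ t = v.1 ∨ t = v.2.1 ∨ t = v.2.2

/-- `IsVTime` is decidable. [cite: MadrasSlade1993, §4.2, remark after Theorem 4.2.4 (p. 94)] -/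
instance (v : ℕ × ℕ × ℕ) : DecidablePred (IsVTime v) := fun t => by unfold IsVTime; infer_instance

section clock

variable {v : ℕ × ℕ × ℕ}

/-- A transverse (flat) time: the clock advances, the height stays. [cite: MadrasSlade1993, §4.2, remark after Theorem 4.2.4 (p. 94)] -/
theorem tau_succ_of_flat (hv : IsVert v) {t : ℕ} (ht9 : t < 9) (hft : ¬ IsVTime v t) :
    tau v (t + 1) = tau v t + 1 ∧ ht v (t + 1) = ht v t ∧ tau v t ≤ 4 := by
  obtain ⟨h1, h2, h3, h4⟩ := hv
  simp only [IsVTime, not_or] at hft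
  obtain ⟨f0, fp, fq, fr⟩ := hft
  refine ⟨?_, ?_, ?_⟩
  · simp only [tau]; split_ifs <;> first | contradiction | omega
  · simp only [ht]; split_ifs <;> first | contradiction | omega
  · simp only [tau]; split_ifs <;> first | contradiction | omega

/-- An up time (`0`, `p`, `r`): the clock stays, the height goes up. [cite: MadrasSlade1993, §4.2, remark after Theorem 4.2.4 (p. 94)] -/
theorem tau_succ_of_up (hv : IsVert v) {t : ℕ} (hup : t = 0 ∨ t = v.1 ∨ t = v.2.2) :
    tau v (t + 1) = tau v t ∧ ht v (t + 1) = ht v t + 1 := by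
  obtain ⟨h1, h2, h3, h4⟩ := hv
  have ht' : t = 0 ∨ t = v.1 ∨ t = v.2.2 := hup
  refine ⟨?_, ?_⟩
  · simp only [tau]; split_ifs <;> first | contradiction | omega
  · simp only [ht]; split_ifs <;> first | contradiction | omega

/-- The down time `q`: the clock stays, the height goes down. [cite: MadrasSlade1993, §4.2, remark after Theorem 4.2.4 (p. 94)] -/
theorem tau_succ_of_down (hv : IsVert v) {t : ℕ} (hdn : t = v.2.1) :
    tau v (t + 1) = tau v t ∧ ht v (t + 1) + 1 = ht v t := by
  obtain ⟨h1, h2, h3, h4⟩ := hv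
  refine ⟨?_, ?_⟩
  · simp only [tau]; split_ifs <;> first | contradiction | omega
  · simp only [ht]; split_ifs <;> first | contradiction | omega

/-- Values at the two ends and the ranges. [cite: MadrasSlade1993, §4.2, remark after Theorem 4.2.4 (p. 94)] -/
theorem clock_bounds (hv : IsVert v) (t : ℕ) :
    tau v 0 = 0 ∧ ht v 0 = 0 ∧ tau v 9 = 5 ∧ ht v 9 = 2 ∧ (1 ≤ t → 1 ≤ ht v t ∧ ht v t ≤ 2) ∧ (t ≤ 9 → tau v t ≤ 5) := by
  obtain ⟨h1, h2, h3, h4⟩ := hv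
  refine ⟨by simp [tau], by simp [ht], ?_, ?_, fun ht1 => ⟨?_, ?_⟩, fun _ => ?_⟩
  · simp only [tau]; split_ifs <;> first | contradiction | omega
  · simp only [ht]; split_ifs <;> first | contradiction | omega
  · simp only [ht]; split_ifs <;> first | contradiction | omega
  · simp only [ht]; split_ifs <;> first | contradiction | omega
  · simp only [tau]; split_ifs <;> first | contradiction | omega

/-- The clock is non-decreasing. [cite: MadrasSlade1993, §4.2, remark after Theorem 4.2.4 (p. 94)] -/
theorem tau_mono (hv : IsVert v) {s t : ℕ} (hst : s ≤ t) : tau v s ≤ tau v t := by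
  obtain ⟨h1, h2, h3, h4⟩ := hv
  simp only [tau]
  split_ifs <;> first | contradiction | omega

/-- Two distinct times `s < t ≤ 9` with the same clock value have different heights. [cite: MadrasSlade1993, §4.2, remark after Theorem 4.2.4 (p. 94)] -/
theorem ht_ne_of_tau_eq (hv : IsVert v) {s t : ℕ} (hst : s < t) (ht9 : t ≤ 9) (he : tau v s = tau v t) : ht v s ≠ ht v t := by
  obtain ⟨h1, h2, h3, h4⟩ := hv
  simp only [tau, ht] at he ⊢
  split_ifs at he ⊢ <;> first | contradiction | omega

/-- Every clock value `i ≤ tau v t` is attained at some time `≤ t`, with any prescribed compatible height: more precisely, for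
`i < j ≤ 5` and two times `s < t ≤ 9` … (discrete intermediate values). We only need: each `m ≤ 4` is the clock value of a flat time.
[cite: MadrasSlade1993, §4.2, remark after Theorem 4.2.4 (p. 94)] -/
theorem exists_flat_of_lt_five (hv : IsVert v) {m : ℕ} (hm : m ≤ 4) : ∃ t, t < 9 ∧ ¬ IsVTime v t ∧ tau v t = m := by
  obtain ⟨h1, h2, h3, h4⟩ := hv
  -- the flat times are `[1, p-1] ∪ [p+1, q-1] ∪ [q+1, r-1] ∪ [r+1, 8]`, with clock values `0 … 4` in order
  by_cases hm1 : m + 2 ≤ v.1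
  · refine ⟨m + 1, by omega, by rintro (h | h | h | h) <;> omega, ?_⟩
    simp only [tau]; split_ifs <;> first | contradiction | omega
  by_cases hm2 : m + 3 ≤ v.2.1
  · refine ⟨m + 2, by omega, by rintro (h | h | h | h) <;> omega, ?_⟩
    simp only [tau]; split_ifs <;> first | contradiction | omega
  by_cases hm3 : m + 4 ≤ v.2.2
  · refine ⟨m + 3, by omega, by rintro (h | h | h | h) <;> omega, ?_⟩
    simp only [tau]; split_ifs <;> first | contradiction | omega
  · refine ⟨m + 4, by omega, by rintro (h | h | h | h) <;> omega, ?_⟩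
    simp only [tau]; split_ifs <;> first | contradiction | omega

end clock

/-! ### Transverse data and the table-driven walks -/

/-- The partial sums `0, u₁, u₁+u₂, …, u₁+⋯+u₅` (frozen from `5`). [cite: MadrasSlade1993, Definition 1.2.4] -/
def psum5 (d : ℕ) (u : Idx5 d) : ℕ → Site (d + 1)
  | 0 => 0
  | 1 => twoStepV d u.1
  | 2 => twoStepV d u.1 + twoStepV d u.2.1
  | 3 => twoStepV d u.1 + twoStepV d u.2.1 + twoStepV d u.2.2.1
  | 4 => twoStepV d u.1 + twoStepV d u.2.1 + twoStepV d u.2.2.1 + twoStepV d u.2.2.2.1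
  | _ + 5 => twoStepV d u.1 + twoStepV d u.2.1 + twoStepV d u.2.2.1 + twoStepV d u.2.2.2.1 + twoStepV d u.2.2.2.2

/-- `psum5` has no `e₀`-component. [cite: MadrasSlade1993, Definition 1.2.4] -/
@[simp] theorem psum5_apply_zero (d : ℕ) (u : Idx5 d) : ∀ m, psum5 d u m 0 = 0
  | 0 => rfl
  | 1 => by simp [psum5]
  | 2 => by simp [psum5]
  | 3 => by simp [psum5]
  | 4 => by simp [psum5]
  | _ + 5 => by simp [psum5]

/-- The `m`-th transverse step (`m = 0, …, 4`). [cite: MadrasSlade1993, Definition 1.2.4] -/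
def nth5 (d : ℕ) (u : Idx5 d) (m : ℕ) : Idx d :=
  if m = 0 then u.1 else if m = 1 then u.2.1 else if m = 2 then u.2.2.1 else if m = 3 then u.2.2.2.1 else u.2.2.2.2

/-- `psum5 (m+1) = psum5 m + u_{m+1}` for `m ≤ 4`. [cite: MadrasSlade1993, Definition 1.2.4] -/
theorem psum5_succ (d : ℕ) (u : Idx5 d) {m : ℕ} (hm : m ≤ 4) : psum5 d u (m + 1) = psum5 d u m + twoStepV d (nth5 d u m) := by
  interval_cases m <;> simp [psum5, nth5]

/-- `psum5` is frozen from `5`. [cite: MadrasSlade1993, Definition 1.2.4] -/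
theorem psum5_of_five_le (d : ℕ) (u : Idx5 d) {m : ℕ} (hm : 5 ≤ m) : psum5 d u m = psum5 d u 5 := by
  obtain ⟨k, rfl⟩ : ∃ k, m = k + 5 := ⟨m - 5, by omega⟩
  rfl

/-- ★ The table-driven walk with vertical times `v` and transverse steps `u` (frozen from time `9`).
[cite: MadrasSlade1993, §4.2, remark after Theorem 4.2.4 (p. 94)] -/
def walk (d : ℕ) (v : ℕ × ℕ × ℕ) (u : Idx5 d) (t : ℕ) : Site (d + 1) :=
  Pi.single 0 (ht v (min t 9) : ℤ) + psum5 d u (tau v (min t 9))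

section generic

variable {d : ℕ} {v : ℕ × ℕ × ℕ}

/-- Heights along `walk`. [cite: MadrasSlade1993, §4.2, remark after Theorem 4.2.4 (p. 94)] -/
theorem walk_apply_zero (v : ℕ × ℕ × ℕ) (u : Idx5 d) (t : ℕ) : walk d v u t 0 = ht v (min t 9) := by
  simp [walk]

/-- `walk` is frozen from `9`. [cite: MadrasSlade1993, §4.2, remark after Theorem 4.2.4 (p. 94)] -/
theorem walk_of_le (v : ℕ × ℕ × ℕ) (u : Idx5 d) {t : ℕ} (ht9 : 9 ≤ t) : walk d v u t = walk d v u 9 := by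
  simp only [walk, min_eq_right ht9, min_self]

/-- `x ↦ x + e₀` is a lattice step. [cite: MadrasSlade1993, Definition 1.2.4] -/
private theorem adj_add_e0' (d : ℕ) (x : Site (d + 1)) : (zdGraph (d + 1)).Adj x (x + Pi.single 0 1) := by
  rw [zdGraph_adj_iff]; exact ⟨0, Or.inl rfl⟩

/-- A flat step of `walk`. [cite: MadrasSlade1993, Definition 1.2.4] -/
theorem walk_succ_of_flat (hv : IsVert v) (u : Idx5 d) {t : ℕ} (ht9 : t < 9) (hft : ¬ IsVTime v t) :
    walk d v u (t + 1) = walk d v u t + twoStepV d (nth5 d u (tau v t)) := by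
  obtain ⟨e1, e2, e3⟩ := tau_succ_of_flat hv ht9 hft
  rw [walk, walk, min_eq_left ht9.le, min_eq_left (by omega : t + 1 ≤ 9), e1, e2, psum5_succ d u e3]; abel

/-- An up step of `walk`. [cite: MadrasSlade1993, Definition 1.2.4] -/
theorem walk_succ_of_up (hv : IsVert v) (u : Idx5 d) {t : ℕ} (hup : t = 0 ∨ t = v.1 ∨ t = v.2.2) :
    walk d v u (t + 1) = walk d v u t + Pi.single 0 1 := by
  have ht9 : t < 9 := by obtain ⟨h1, h2, h3, h4⟩ := hv; rcases hup with rfl | rfl | rfl <;> omega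
  obtain ⟨e1, e2⟩ := tau_succ_of_up hv hup
  rw [walk, walk, min_eq_left ht9.le, min_eq_left (by omega : t + 1 ≤ 9), e1, e2, Nat.cast_add, Nat.cast_one, Pi.single_add]; abel

/-- The down step of `walk`. [cite: MadrasSlade1993, Definition 1.2.4] -/
theorem walk_succ_of_down (hv : IsVert v) (u : Idx5 d) {t : ℕ} (hdn : t = v.2.1) :
    walk d v u (t + 1) = walk d v u t - Pi.single 0 1 := by
  have ht9 : t < 9 := by obtain ⟨h1, h2, h3, h4⟩ := hv; omega
  obtain ⟨e1, e2⟩ := tau_succ_of_down hv hdn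
  rw [walk, walk, min_eq_left ht9.le, min_eq_left (by omega : t + 1 ≤ 9), e1, ← e2, Nat.cast_add, Nat.cast_one, Pi.single_add]
  abel

/-- Consecutive sites of `walk` are lattice neighbours. [cite: MadrasSlade1993, Definition 1.2.4] -/
theorem walk_adj (hv : IsVert v) (u : Idx5 d) {t : ℕ} (ht9 : t < 9) : (zdGraph (d + 1)).Adj (walk d v u t) (walk d v u (t + 1)) := by
  by_cases hft : IsVTime v t
  · rcases hft with h | h | h | h
    · rw [walk_succ_of_up hv u (Or.inl h)]; exact adj_add_e0' d _
    · rw [walk_succ_of_up hv u (Or.inr (Or.inl h))]; exact adj_add_e0' d _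
    · have e := walk_succ_of_down hv u h
      rw [show walk d v u t = walk d v u (t + 1) + Pi.single 0 1 by rw [e]; abel]
      exact (adj_add_e0' d _).symm
    · rw [walk_succ_of_up hv u (Or.inr (Or.inr h))]; exact adj_add_e0' d _
  · rw [walk_succ_of_flat hv u ht9 hft]; exact adj_add_twoStepV d _ _

/-- `walk` is a bridge of span two. [cite: MadrasSlade1993, §4.2, remark after Theorem 4.2.4 (p. 94)] -/
theorem walk_isBridge (hv : IsVert v) (u : Idx5 d) : IsBridge 9 (walk d v u) := by
  intro i hi1 hi9
  rw [walk_apply_zero, walk_apply_zero, walk_apply_zero, min_eq_left hi9, Nat.zero_min, min_self]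
  obtain ⟨-, h0, -, h9, hr, -⟩ := clock_bounds hv i
  obtain ⟨h1', h2'⟩ := hr hi1
  rw [h0, h9]
  exact ⟨by exact_mod_cast h1', by exact_mod_cast h2'⟩

/-- The height table on its four runs. [cite: MadrasSlade1993, §4.2, remark after Theorem 4.2.4 (p. 94)] -/
theorem ht_runs (hv : IsVert v) :
    (∀ k, 1 ≤ k → k ≤ v.1 → ht v k = 1) ∧ (∀ k, v.1 < k → k ≤ v.2.1 → ht v k = 2) ∧ (∀ k, v.2.1 < k → k ≤ v.2.2 → ht v k = 1) ∧
      (∀ k, v.2.2 < k → ht v k = 2) := by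
  obtain ⟨h1, h2, h3, h4⟩ := hv
  refine ⟨fun k hk1 hk2 => ?_, fun k hk1 hk2 => ?_, fun k hk1 hk2 => ?_, fun k hk1 => ?_⟩ <;> simp only [ht] <;> split_ifs <;> omega

/-- `walk` has no renewal time in `[1, 8]`: at a time of height `2` the end is not higher; at a time of height `1` either a later
time has height `1` or an earlier time has height `2`. [cite: DuminilCopinHammond2013, §2.2] -/
theorem walk_not_renewal (hv : IsVert v) (u : Idx5 d) {k : ℕ} (hk1 : 1 ≤ k) (hk8 : k ≤ 9 - 1) : ¬ IsRenewalTime 9 (walk d v u) k := by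
  rintro ⟨-, hb1, hb2⟩
  have hle : ∀ i, 1 ≤ i → i ≤ k → ht v i ≤ ht v k := by
    intro i hi1 hi2
    have := (hb1 i hi1 hi2).2
    rw [walk_apply_zero, walk_apply_zero, min_eq_left (by omega : i ≤ 9), min_eq_left (by omega : k ≤ 9)] at this
    exact_mod_cast this
  have hgt : ∀ j, 1 ≤ j → j ≤ 9 - k → ht v k < ht v (k + j) := by
    intro j hj1 hj2
    have := (hb2 j hj1 hj2).1
    simp only [add_zero] at this
    rw [walk_apply_zero, walk_apply_zero, min_eq_left (by omega : k ≤ 9), min_eq_left (by omega : k + j ≤ 9)] at this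
    exact_mod_cast this
  obtain ⟨h1, h2, h3, h4⟩ := hv
  obtain ⟨r1, r2, r3, r4⟩ := ht_runs ⟨h1, h2, h3, h4⟩
  have e9 := hgt (9 - k) (by omega) le_rfl
  rw [show k + (9 - k) = 9 by omega, r4 9 (by omega)] at e9
  -- so `ht v k = 1`: `k ≤ p` or `q < k ≤ r`
  by_cases hkp : k ≤ v.1
  · -- the later time `r` has height `1`
    have := hgt (v.2.2 - k) (by omega) (by omega)
    rw [show k + (v.2.2 - k) = v.2.2 by omega, r3 v.2.2 (by omega) le_rfl, r1 k hk1 hkp] at this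
    exact lt_irrefl _ this
  · by_cases hkq : k ≤ v.2.1
    · rw [r2 k (by omega) hkq] at e9; exact lt_irrefl _ e9
    · by_cases hkr : k ≤ v.2.2
      · -- the earlier time `p + 1` has height `2`
        have := hle (v.1 + 1) (by omega) (by omega)
        rw [r2 (v.1 + 1) (by omega) (by omega), r3 k (by omega) hkr] at this
        omega
      · rw [r4 k (by omega)] at e9; exact lt_irrefl _ e9

/-- Self-avoiding members of the family are irreducible bridges of cost seven. [cite: DuminilCopinHammond2013, §2.2] -/
theorem walk_mem_filter (hv : IsVert v) {u : Idx5 d} (hu : walk d v u ∈ saws (d + 1) 9) :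
    walk d v u ∈ (irreducibleBridges (d + 1) 9).filter fun ω => costZd d 9 ω = 7 := by
  refine Finset.mem_filter.2 ⟨mem_irreducibleBridges.2 ⟨mem_bridges.2 ⟨hu, walk_isBridge hv u⟩,
    ⟨by omega, walk_isBridge hv u, fun k hk1 hk2 => walk_not_renewal hv u hk1 hk2⟩⟩, ?_⟩
  rw [costZd, walk_apply_zero, min_self, (clock_bounds hv 0).2.2.2.1]
  rfl

/-- The flat times of `walk` are exactly the non-vertical times. [cite: MadrasSlade1993, §4.2, remark after Theorem 4.2.4 (p. 94)] -/
theorem walk_flat_iff (hv : IsVert v) (u : Idx5 d) {t : ℕ} (ht9 : t < 9) :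
    walk d v u (t + 1) 0 = walk d v u t 0 ↔ ¬ IsVTime v t := by
  rw [walk_apply_zero, walk_apply_zero, min_eq_left (by omega : t + 1 ≤ 9), min_eq_left ht9.le]
  constructor
  · intro h hvt
    rcases hvt with h' | h' | h' | h'
    · have := (tau_succ_of_up hv (Or.inl h')).2; rw [this] at h; push_cast at h; linarith
    · have := (tau_succ_of_up hv (Or.inr (Or.inl h'))).2; rw [this] at h; push_cast at h; linarith
    · have := (tau_succ_of_down hv h').2; rw [← this] at h; push_cast at h; linarith
    · have := (tau_succ_of_up hv (Or.inr (Or.inr h'))).2; rw [this] at h; push_cast at h; linarith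
  · intro hft; rw [(tau_succ_of_flat hv ht9 hft).2.1]

/-- `walk d v` is injective in the transverse data. [cite: MadrasSlade1993, Definition 1.2.4] -/
theorem walk_injective (hv : IsVert v) : Function.Injective (walk d v) := by
  intro u u' h
  have key : ∀ m, m ≤ 4 → twoStepV d (nth5 d u m) = twoStepV d (nth5 d u' m) := by
    intro m hm
    obtain ⟨t, ht9, hft, htm⟩ := exists_flat_of_lt_five hv hm
    have e1 := walk_succ_of_flat hv u ht9 hft
    have e2 := walk_succ_of_flat hv u' ht9 hft
    rw [h] at e1
    rw [htm] at e1 e2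
    exact add_left_cancel (e1.symm.trans e2)
  have k0 := key 0 (by norm_num); have k1 := key 1 (by norm_num); have k2 := key 2 (by norm_num)
  have k3 := key 3 (by norm_num); have k4 := key 4 (by norm_num)
  obtain ⟨u1, u2, u3, u4, u5⟩ := u; obtain ⟨w1, w2, w3, w4, w5⟩ := u'
  simp only [nth5] at k0 k1 k2 k3 k4
  norm_num at k0 k1 k2 k3 k4
  rw [twoStepV_injective d k0, twoStepV_injective d k1, twoStepV_injective d k2, twoStepV_injective d k3, twoStepV_injective d k4]

/-- Two members of table-driven families that coincide have the same vertical times. [cite: MadrasSlade1993, §4.2, remark after Theorem 4.2.4 (p. 94)] -/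
theorem verts_eq_of_eq {v v' : ℕ × ℕ × ℕ} (hv : IsVert v) (hv' : IsVert v') {u u' : Idx5 d} (h : walk d v u = walk d v' u') : v = v' := by
  have key : ∀ t, t < 9 → (IsVTime v t ↔ IsVTime v' t) := by
    intro t ht9
    have h2 : (walk d v u (t + 1) 0 = walk d v u t 0 ↔ ¬ IsVTime v' t) := by rw [h]; exact walk_flat_iff hv' u' ht9
    exact not_iff_not.1 ((walk_flat_iff hv u ht9).symm.trans h2)
  obtain ⟨p, q, r⟩ := v
  obtain ⟨p', q', r'⟩ := v'
  obtain ⟨h1, h2, h3, h4⟩ := hv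
  obtain ⟨h1', h2', h3', h4'⟩ := hv'
  simp only [IsVTime] at key h1 h2 h3 h4 h1' h2' h3' h4' ⊢
  have kp := (key p (by omega)).1 (by omega)
  have kq := (key q (by omega)).1 (by omega)
  have kr := (key r (by omega)).1 (by omega)
  have kp' := (key p' (by omega)).2 (by omega)
  have kq' := (key q' (by omega)).2 (by omega)
  have kr' := (key r' (by omega)).2 (by omega)
  simp only [Prod.mk.injEq]
  omega

end generic


/-! ### Four transverse unit steps summing to zero -/

/-- ★ Four transverse unit steps sum to zero iff they cancel in pairs. [cite: MadrasSlade1993, Definition 1.2.4] -/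
theorem sum_four_eq_zero_iff (d : ℕ) (a b c e : Idx d) :
    twoStepV d a + twoStepV d b + twoStepV d c + twoStepV d e = 0 ↔
      (b = revIdx a ∧ e = revIdx c) ∨ (c = revIdx a ∧ e = revIdx b) ∨ (e = revIdx a ∧ c = revIdx b) := by
  constructor
  · intro h
    -- one of `b, c, e` is `−a` (inner product with `v_a`)
    have hone : b = revIdx a ∨ c = revIdx a ∨ e = revIdx a := by
      by_contra hne
      simp only [not_or] at hne
      obtain ⟨hb, hc, he⟩ := hne
      have hφ := congrArg (fun x : Site (d + 1) => ∑ i, twoStepV d a i * x i) h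
      simp only [Pi.add_apply, Pi.zero_apply, mul_add, mul_zero, Finset.sum_const_zero, Finset.sum_add_distrib] at hφ
      rw [sum_twoStepV_mul_self] at hφ
      have h1 := (sum_twoStepV_mul_twoStepV_cases d a b).1 hb
      have h2 := (sum_twoStepV_mul_twoStepV_cases d a c).1 hc
      have h3 := (sum_twoStepV_mul_twoStepV_cases d a e).1 he
      linarith
    rcases hone with hb | hc | he
    · left
      refine ⟨hb, ?_⟩
      have h2 : twoStepV d c + twoStepV d e = 0 := by
        rw [hb, twoStepV_revIdx] at h; rw [← h]; abel
      exact (twoStepV_add_eq_zero_iff d c e).1 h2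
    · right; left
      refine ⟨hc, ?_⟩
      have h2 : twoStepV d b + twoStepV d e = 0 := by
        rw [hc, twoStepV_revIdx] at h; rw [← h]; abel
      exact (twoStepV_add_eq_zero_iff d b e).1 h2
    · right; right
      refine ⟨he, ?_⟩
      have h2 : twoStepV d b + twoStepV d c = 0 := by
        rw [he, twoStepV_revIdx] at h; rw [← h]; abel
      exact (twoStepV_add_eq_zero_iff d b c).1 h2
  · rintro (⟨h1, h2⟩ | ⟨h1, h2⟩ | ⟨h1, h2⟩) <;> rw [h1, h2, twoStepV_revIdx, twoStepV_revIdx] <;> abel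

/-! ### Self-avoidance of the table-driven walks: a block condition on the transverse steps -/

/-- Do the clock values `i < j` occur at two times of the same height?  (Boolean, by enumeration of the times `≤ 9`.)
[cite: MadrasSlade1993, §4.2, remark after Theorem 4.2.4 (p. 94)] -/
def sameLevel (v : ℕ × ℕ × ℕ) (i j : ℕ) : Bool :=
  (List.range 10).any fun t => (List.range t).any fun s => ht v s == ht v t && tau v s == i && tau v t == j

/-- `sameLevel` from a witness. [cite: MadrasSlade1993, §4.2, remark after Theorem 4.2.4 (p. 94)] -/
theorem sameLevel_of_witness {v : ℕ × ℕ × ℕ} {s t : ℕ} (hst : s < t) (ht9 : t ≤ 9) (hh : ht v s = ht v t) :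
    sameLevel v (tau v s) (tau v t) = true := by
  simp only [sameLevel, List.any_eq_true, List.mem_range, Bool.and_eq_true, beq_iff_eq]
  exact ⟨t, by omega, s, hst, ⟨hh, rfl⟩, rfl⟩

/-- A witness from `sameLevel`. [cite: MadrasSlade1993, §4.2, remark after Theorem 4.2.4 (p. 94)] -/
theorem witness_of_sameLevel {v : ℕ × ℕ × ℕ} {i j : ℕ} (h : sameLevel v i j = true) :
    ∃ s t, s < t ∧ t ≤ 9 ∧ ht v s = ht v t ∧ tau v s = i ∧ tau v t = j := by
  simp only [sameLevel, List.any_eq_true, List.mem_range, Bool.and_eq_true, beq_iff_eq] at h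
  obtain ⟨t, ht10, s, hst, ⟨hh, hs⟩, ht'⟩ := h
  exact ⟨s, t, hst, by omega, hh, hs, ht'⟩

/-- The signature of the vertical times `v`: which of the six even-gap pairs of clock values `(0,2), (1,3), (2,4), (3,5), (0,4), (1,5)`
occur at a common height. [cite: MadrasSlade1993, §4.2, remark after Theorem 4.2.4 (p. 94)] -/
def sig (v : ℕ × ℕ × ℕ) : Bool × Bool × Bool × Bool × Bool × Bool :=
  (sameLevel v 0 2, sameLevel v 1 3, sameLevel v 2 4, sameLevel v 3 5, sameLevel v 0 4, sameLevel v 1 5)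

/-- The block condition on the transverse steps `u = (a, b, c, e, f)` prescribed by a signature `σ`: for each flagged pair of clock
values `i < j` the steps `u_{i+1} + ⋯ + u_j` do not sum to zero (`b ≠ −a`, `c ≠ −b`, `e ≠ −c`, `f ≠ −e`, `a+b+c+e ≠ 0`, `b+c+e+f ≠ 0`).
[cite: MadrasSlade1993, §4.2, remark after Theorem 4.2.4 (p. 94)] -/
def GoodSig (d : ℕ) (σ : Bool × Bool × Bool × Bool × Bool × Bool) (u : Idx5 d) : Prop :=
  (σ.1 = true → u.2.1 ≠ revIdx u.1) ∧ (σ.2.1 = true → u.2.2.1 ≠ revIdx u.2.1) ∧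
  (σ.2.2.1 = true → u.2.2.2.1 ≠ revIdx u.2.2.1) ∧ (σ.2.2.2.1 = true → u.2.2.2.2 ≠ revIdx u.2.2.2.1) ∧
  (σ.2.2.2.2.1 = true → twoStepV d u.1 + twoStepV d u.2.1 + twoStepV d u.2.2.1 + twoStepV d u.2.2.2.1 ≠ 0) ∧
  (σ.2.2.2.2.2 = true → twoStepV d u.2.1 + twoStepV d u.2.2.1 + twoStepV d u.2.2.2.1 + twoStepV d u.2.2.2.2 ≠ 0)

/-- `GoodSig` is decidable. [cite: MadrasSlade1993, §4.2, remark after Theorem 4.2.4 (p. 94)] -/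
instance (d : ℕ) (σ : Bool × Bool × Bool × Bool × Bool × Bool) : DecidablePred (GoodSig d σ) := fun u => by
  unfold GoodSig; infer_instance

/-- The block condition prescribed by the vertical times `v`. [cite: MadrasSlade1993, §4.2, remark after Theorem 4.2.4 (p. 94)] -/
abbrev Good (d : ℕ) (v : ℕ × ℕ × ℕ) (u : Idx5 d) : Prop := GoodSig d (sig v) u

section selfavoid

variable {d : ℕ} {v : ℕ × ℕ × ℕ}

/-- Two sites of `walk` coincide iff their heights and their transverse partial sums do. [cite: MadrasSlade1993, Definition 1.2.4] -/
theorem walk_eq_iff (u : Idx5 d) {s t : ℕ} (hs : s ≤ 9) (ht9 : t ≤ 9) :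
    walk d v u s = walk d v u t ↔ ht v s = ht v t ∧ psum5 d u (tau v s) = psum5 d u (tau v t) := by
  constructor
  · intro h
    have h0 := congrFun h 0
    rw [walk_apply_zero, walk_apply_zero, min_eq_left hs, min_eq_left ht9] at h0
    have h0' : ht v s = ht v t := by exact_mod_cast h0
    refine ⟨h0', ?_⟩
    rw [walk, walk, min_eq_left hs, min_eq_left ht9, h0'] at h
    exact add_left_cancel h
  · rintro ⟨h1, h2⟩
    rw [walk, walk, min_eq_left hs, min_eq_left ht9, h1, h2]

/-- The blocks of `psum5`: differences of partial sums. [cite: MadrasSlade1993, Definition 1.2.4] -/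
theorem psum5_vals (u : Idx5 d) :
    psum5 d u 0 = 0 ∧ psum5 d u 1 = twoStepV d u.1 ∧ psum5 d u 2 = twoStepV d u.1 + twoStepV d u.2.1 ∧
    psum5 d u 3 = twoStepV d u.1 + twoStepV d u.2.1 + twoStepV d u.2.2.1 ∧
    psum5 d u 4 = twoStepV d u.1 + twoStepV d u.2.1 + twoStepV d u.2.2.1 + twoStepV d u.2.2.2.1 ∧
    psum5 d u 5 = twoStepV d u.1 + twoStepV d u.2.1 + twoStepV d u.2.2.1 + twoStepV d u.2.2.2.1 + twoStepV d u.2.2.2.2 :=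
  ⟨rfl, rfl, rfl, rfl, rfl, rfl⟩

/-- ★ **Self-avoidance of `walk v u` is the block condition `Good v u`.** [cite: MadrasSlade1993, §4.2, remark after Theorem 4.2.4 (p. 94)] -/
theorem walk_mem_saws_iff (hv : IsVert v) (u : Idx5 d) : walk d v u ∈ saws (d + 1) 9 ↔ Good d v u := by
  obtain ⟨a, b, c, e, f⟩ := u
  obtain ⟨p0, p1, p2, p3, p4, p5⟩ := psum5_vals (d := d) (a, b, c, e, f)
  simp only at p1 p2 p3 p4 p5
  constructor
  · intro hω
    obtain ⟨-, -, -, hinj⟩ := mem_saws.1 hω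
    -- a coincidence of partial sums at two times of the same height contradicts injectivity
    have key : ∀ i j, sameLevel v i j = true → psum5 d (a, b, c, e, f) i ≠ psum5 d (a, b, c, e, f) j := by
      intro i j hij hEq
      obtain ⟨s, t, hst, ht9, hh, rfl, rfl⟩ := witness_of_sameLevel hij
      have := hinj (show s ∈ {k : ℕ | k ≤ 9} from by simp; omega) (show t ∈ {k : ℕ | k ≤ 9} from ht9)
        ((walk_eq_iff (a, b, c, e, f) (by omega) ht9).2 ⟨hh, hEq⟩)
      omega
    simp only [Good, GoodSig, sig]
    refine ⟨fun h hba => key 0 2 h ?_, fun h hcb => key 1 3 h ?_, fun h hec => key 2 4 h ?_, fun h hfe => key 3 5 h ?_,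
      fun h h4 => key 0 4 h ?_, fun h h4 => key 1 5 h ?_⟩
    · rw [p0, p2, hba, twoStepV_revIdx]; abel
    · rw [p1, p3, hcb, twoStepV_revIdx]; abel
    · rw [p2, p4, hec, twoStepV_revIdx]; abel
    · rw [p3, p5, hfe, twoStepV_revIdx]; abel
    · rw [p0, p4, h4]
    · rw [p1, p5]
      have e5 : twoStepV d a + twoStepV d b + twoStepV d c + twoStepV d e + twoStepV d f =
          twoStepV d a + (twoStepV d b + twoStepV d c + twoStepV d e + twoStepV d f) := by abel
      rw [e5, h4, add_zero]
  · intro hg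
    simp only [Good, GoodSig, sig] at hg
    obtain ⟨g02, g13, g24, g35, g04, g15⟩ := hg
    refine mem_saws.2 ⟨?_, fun i hi => walk_of_le v _ hi, fun i hi => walk_adj hv _ hi, ?_⟩
    · rw [walk, Nat.zero_min, (clock_bounds hv 0).1, (clock_bounds hv 0).2.1]; simp [psum5]
    · -- injectivity
      have main : ∀ s t, s < t → t ≤ 9 → walk d v (a, b, c, e, f) s ≠ walk d v (a, b, c, e, f) t := by
        intro s t hst ht9 hEq
        obtain ⟨hh, hps⟩ := (walk_eq_iff (a, b, c, e, f) (by omega) ht9).1 hEq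
        have hne : tau v s ≠ tau v t := fun he => ht_ne_of_tau_eq hv hst ht9 he hh
        have hlt : tau v s < tau v t := lt_of_le_of_ne (tau_mono hv hst.le) hne
        have hj5 : tau v t ≤ 5 := (clock_bounds hv t).2.2.2.2.2 ht9
        have hsl := sameLevel_of_witness hst ht9 hh
        -- case analysis on the two clock values
        generalize hi : tau v s = i at hlt hsl hps
        generalize hj : tau v t = j at hlt hsl hps hj5
        have hcases : (i = 0 ∧ j = 1) ∨ (i = 0 ∧ j = 2) ∨ (i = 1 ∧ j = 2) ∨ (i = 0 ∧ j = 3) ∨ (i = 1 ∧ j = 3) ∨ (i = 2 ∧ j = 3) ∨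
            (i = 0 ∧ j = 4) ∨ (i = 1 ∧ j = 4) ∨ (i = 2 ∧ j = 4) ∨ (i = 3 ∧ j = 4) ∨ (i = 0 ∧ j = 5) ∨ (i = 1 ∧ j = 5) ∨ (i = 2 ∧ j = 5) ∨
            (i = 3 ∧ j = 5) ∨ (i = 4 ∧ j = 5) := by
          clear hps hsl hi hj
          interval_cases j <;> interval_cases i <;> decide
        rcases hcases with ⟨rfl, rfl⟩ | ⟨rfl, rfl⟩ | ⟨rfl, rfl⟩ | ⟨rfl, rfl⟩ | ⟨rfl, rfl⟩ | ⟨rfl, rfl⟩ | ⟨rfl, rfl⟩ | ⟨rfl, rfl⟩ |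
          ⟨rfl, rfl⟩ | ⟨rfl, rfl⟩ | ⟨rfl, rfl⟩ | ⟨rfl, rfl⟩ | ⟨rfl, rfl⟩ | ⟨rfl, rfl⟩ | ⟨rfl, rfl⟩
        · -- (0,1)
          rw [p0, p1] at hps; exact twoStepV_ne_zero d a hps.symm
        · -- (0,2)
          rw [p0, p2] at hps
          exact g02 hsl ((twoStepV_add_eq_zero_iff d a b).1 hps.symm)
        · -- (1,2)
          rw [p1, p2] at hps
          exact twoStepV_ne_zero d b (by have := hps.symm; rw [add_eq_left] at this; exact this)
        · -- (0,3)
          rw [p0, p3] at hps; exact twoStepV_add_add_ne_zero d a b c hps.symm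
        · -- (1,3)
          rw [p1, p3] at hps
          have h2 : twoStepV d b + twoStepV d c = 0 := by
            have := hps.symm; rw [add_assoc, add_eq_left] at this; exact this
          exact g13 hsl ((twoStepV_add_eq_zero_iff d b c).1 h2)
        · -- (2,3)
          rw [p2, p3] at hps
          exact twoStepV_ne_zero d c (by have := hps.symm; rw [add_eq_left] at this; exact this)
        · -- (0,4)
          rw [p0, p4] at hps; exact g04 hsl hps.symm
        · -- (1,4)
          rw [p1, p4] at hps
          have h3 : twoStepV d b + twoStepV d c + twoStepV d e = 0 := by
            have := hps.symm; rw [add_assoc, add_assoc, add_eq_left, ← add_assoc] at this; exact this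
          exact twoStepV_add_add_ne_zero d b c e h3
        · -- (2,4)
          rw [p2, p4] at hps
          have h2 : twoStepV d c + twoStepV d e = 0 := by
            have := hps.symm; rw [add_assoc, add_eq_left] at this; exact this
          exact g24 hsl ((twoStepV_add_eq_zero_iff d c e).1 h2)
        · -- (3,4)
          rw [p3, p4] at hps
          exact twoStepV_ne_zero d e (by have := hps.symm; rw [add_eq_left] at this; exact this)
        · -- (0,5)
          rw [p0, p5] at hps; exact twoStepV_sum_five_ne_zero d a b c e f hps.symm
        · -- (1,5)
          rw [p1, p5] at hps
          have h4 : twoStepV d b + twoStepV d c + twoStepV d e + twoStepV d f = 0 := by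
            have := hps.symm
            rw [add_assoc, add_assoc, add_assoc, add_eq_left, ← add_assoc, ← add_assoc] at this; exact this
          exact g15 hsl h4
        · -- (2,5)
          rw [p2, p5] at hps
          have h3 : twoStepV d c + twoStepV d e + twoStepV d f = 0 := by
            have := hps.symm; rw [add_assoc, add_assoc, add_eq_left, ← add_assoc] at this; exact this
          exact twoStepV_add_add_ne_zero d c e f h3
        · -- (3,5)
          rw [p3, p5] at hps
          have h2 : twoStepV d e + twoStepV d f = 0 := by
            have := hps.symm; rw [add_assoc, add_eq_left] at this; exact this
          exact g35 hsl ((twoStepV_add_eq_zero_iff d e f).1 h2)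
        · -- (4,5)
          rw [p4, p5] at hps
          exact twoStepV_ne_zero d f (by have := hps.symm; rw [add_eq_left] at this; exact this)
      intro s hs t ht9 hEq
      simp only [Set.mem_setOf_eq] at hs ht9
      rcases lt_trichotomy s t with hst | rfl | hts
      · exact absurd hEq (main s t hst ht9)
      · rfl
      · exact absurd hEq.symm (main t s hts hs)

/-- The words satisfying the block condition of a signature. [cite: MadrasSlade1993, §4.2, remark after Theorem 4.2.4 (p. 94)] -/
def admSig (d : ℕ) (σ : Bool × Bool × Bool × Bool × Bool × Bool) : Finset (Idx5 d) := Finset.univ.filter (GoodSig d σ)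

/-- The fibre of `v`: the transverse data of the self-avoiding members. [cite: MadrasSlade1993, §4.2, remark after Theorem 4.2.4 (p. 94)] -/
def adm (d : ℕ) (v : ℕ × ℕ × ℕ) : Finset (Idx5 d) := admSig d (sig v)

/-- Membership in the fibre. [cite: MadrasSlade1993, §4.2, remark after Theorem 4.2.4 (p. 94)] -/
theorem mem_adm_iff (hv : IsVert v) {u : Idx5 d} : u ∈ adm d v ↔ walk d v u ∈ saws (d + 1) 9 := by
  rw [adm, admSig, Finset.mem_filter, walk_mem_saws_iff hv]; simp

end selfavoid


/-! ### The converse: every cost-seven irreducible bridge of length nine is a table-driven walk -/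

section converse

variable {d : ℕ} {v : ℕ × ℕ × ℕ}

/-- Two flat times with the same clock value coincide. [cite: MadrasSlade1993, §4.2, remark after Theorem 4.2.4 (p. 94)] -/
theorem flat_unique (hv : IsVert v) {t t' : ℕ} (ht9 : t < 9) (ht9' : t' < 9) (hft : ¬ IsVTime v t) (hft' : ¬ IsVTime v t')
    (he : tau v t = tau v t') : t = t' := by
  by_contra hne
  rcases Nat.lt_or_gt_of_ne hne with hlt | hlt
  · have h1 := (tau_succ_of_flat hv ht9 hft).1
    have h2 := tau_mono hv (show t + 1 ≤ t' by omega)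
    omega
  · have h1 := (tau_succ_of_flat hv ht9' hft').1
    have h2 := tau_mono hv (show t' + 1 ≤ t by omega)
    omega

/-- A self-avoiding walk whose heights follow the table `ht v` is `walk v u` for the transverse steps `u` it takes at the five flat times.
[cite: MadrasSlade1993, §4.2, remark after Theorem 4.2.4 (p. 94)] -/
theorem exists_eq_walk_of_heights (hv : IsVert v) {ω : ℕ → Site (d + 1)} (hω : ω ∈ saws (d + 1) 9)
    (hH : ∀ t, t ≤ 9 → ω t 0 = ht v t) : ∃ u : Idx5 d, ω = walk d v u := by
  obtain ⟨h0, hend, hadj, -⟩ := mem_saws.1 hω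
  -- heights are constant across flat times
  have hflatH : ∀ t, t < 9 → ¬ IsVTime v t → ω (t + 1) 0 = ω t 0 := by
    intro t ht9 hft
    rw [hH (t + 1) (by omega), hH t ht9.le, (tau_succ_of_flat hv ht9 hft).2.1]
  obtain ⟨t0, h90, hf0, hc0⟩ := exists_flat_of_lt_five hv (m := 0) (by norm_num)
  obtain ⟨t1, h91, hf1, hc1⟩ := exists_flat_of_lt_five hv (m := 1) (by norm_num)
  obtain ⟨t2, h92, hf2, hc2⟩ := exists_flat_of_lt_five hv (m := 2) (by norm_num)
  obtain ⟨t3, h93, hf3, hc3⟩ := exists_flat_of_lt_five hv (m := 3) (by norm_num)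
  obtain ⟨t4, h94, hf4, hc4⟩ := exists_flat_of_lt_five hv (m := 4) (by norm_num)
  obtain ⟨w0, hw0⟩ := exists_twoStepV_of_adj d (hadj t0 h90) (hflatH t0 h90 hf0)
  obtain ⟨w1, hw1⟩ := exists_twoStepV_of_adj d (hadj t1 h91) (hflatH t1 h91 hf1)
  obtain ⟨w2, hw2⟩ := exists_twoStepV_of_adj d (hadj t2 h92) (hflatH t2 h92 hf2)
  obtain ⟨w3, hw3⟩ := exists_twoStepV_of_adj d (hadj t3 h93) (hflatH t3 h93 hf3)
  obtain ⟨w4, hw4⟩ := exists_twoStepV_of_adj d (hadj t4 h94) (hflatH t4 h94 hf4)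
  set u : Idx5 d := (w0, w1, w2, w3, w4) with hu
  have main : ∀ t, t ≤ 9 → ω t = walk d v u t := by
    intro t
    induction t with
    | zero =>
      intro _
      rw [h0, walk, Nat.zero_min, (clock_bounds hv 0).1, (clock_bounds hv 0).2.1]; simp [psum5]
    | succ t ih =>
      intro ht9
      have prev := ih (by omega)
      by_cases hft : IsVTime v t
      · rcases hft with hx | hx | hx | hx
        · have hup : ω (t + 1) 0 = ω t 0 + 1 := by
            rw [hH (t + 1) ht9, hH t (by omega), (tau_succ_of_up hv (Or.inl hx)).2]; push_cast; ring
          rw [eq_add_e0_of_adj d (hadj t (by omega)) hup, prev, walk_succ_of_up hv u (Or.inl hx)]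
        · have hup : ω (t + 1) 0 = ω t 0 + 1 := by
            rw [hH (t + 1) ht9, hH t (by omega), (tau_succ_of_up hv (Or.inr (Or.inl hx))).2]; push_cast; ring
          rw [eq_add_e0_of_adj d (hadj t (by omega)) hup, prev, walk_succ_of_up hv u (Or.inr (Or.inl hx))]
        · have hdn : ω (t + 1) 0 = ω t 0 - 1 := by
            rw [hH (t + 1) ht9, hH t (by omega), ← (tau_succ_of_down hv hx).2]; push_cast; ring
          rw [eq_sub_e0_of_adj d (hadj t (by omega)) hdn, prev, walk_succ_of_down hv u hx]
        · have hup : ω (t + 1) 0 = ω t 0 + 1 := by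
            rw [hH (t + 1) ht9, hH t (by omega), (tau_succ_of_up hv (Or.inr (Or.inr hx))).2]; push_cast; ring
          rw [eq_add_e0_of_adj d (hadj t (by omega)) hup, prev, walk_succ_of_up hv u (Or.inr (Or.inr hx))]
      · have ht9' : t < 9 := by omega
        rw [walk_succ_of_flat hv u ht9' hft, ← prev]
        have hm4 := (tau_succ_of_flat hv ht9' hft).2.2
        have hcases : tau v t = 0 ∨ tau v t = 1 ∨ tau v t = 2 ∨ tau v t = 3 ∨ tau v t = 4 := by omega
        rcases hcases with hm | hm | hm | hm | hm
        · obtain rfl := flat_unique hv ht9' h90 hft hf0 (hm.trans hc0.symm)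
          rw [hw0, hm]; simp [nth5, hu]
        · obtain rfl := flat_unique hv ht9' h91 hft hf1 (hm.trans hc1.symm)
          rw [hw1, hm]; simp [nth5, hu]
        · obtain rfl := flat_unique hv ht9' h92 hft hf2 (hm.trans hc2.symm)
          rw [hw2, hm]; simp [nth5, hu]
        · obtain rfl := flat_unique hv ht9' h93 hft hf3 (hm.trans hc3.symm)
          rw [hw3, hm]; simp [nth5, hu]
        · obtain rfl := flat_unique hv ht9' h94 hft hf4 (hm.trans hc4.symm)
          rw [hw4, hm]; simp [nth5, hu]
  refine ⟨u, funext fun t => ?_⟩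
  rcases Nat.lt_or_ge t 10 with ht | ht
  · exact main t (by omega)
  · rw [hend t (by omega), walk_of_le v u (show 9 ≤ t by omega), main 9 le_rfl]

/-- Ten listed heights give the height table. [cite: MadrasSlade1993, §4.2, remark after Theorem 4.2.4 (p. 94)] -/
theorem heights_intro (v : ℕ × ℕ × ℕ) {ω : ℕ → Site (d + 1)}
    (h : ω 0 0 = ht v 0 ∧ ω 1 0 = ht v 1 ∧ ω 2 0 = ht v 2 ∧ ω 3 0 = ht v 3 ∧ ω 4 0 = ht v 4 ∧ ω 5 0 = ht v 5 ∧ ω 6 0 = ht v 6 ∧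
      ω 7 0 = ht v 7 ∧ ω 8 0 = ht v 8 ∧ ω 9 0 = ht v 9) : ∀ t, t ≤ 9 → ω t 0 = ht v t := by
  obtain ⟨h0, h1, h2, h3, h4, h5, h6, h7, h8, h9⟩ := h
  intro t ht9
  interval_cases t <;> assumption

/-- ★ The height profile of a cost-seven irreducible bridge of length nine: heights in `{1, 2}`, no up-down and no down-up pair, not
monotone ⇒ one of the twenty tables `ht v`. [cite: DuminilCopinHammond2013, §2.2] -/
theorem exists_vert_of_mem {ω : ℕ → Site (d + 1)}
    (hω : ω ∈ (irreducibleBridges (d + 1) 9).filter fun ω => costZd d 9 ω = 7) :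
    ∃ v : ℕ × ℕ × ℕ, IsVert v ∧ ∀ t, t ≤ 9 → ω t 0 = ht v t := by
  obtain ⟨hirr, hcost⟩ := Finset.mem_filter.1 hω
  obtain ⟨hbr, -⟩ := mem_irreducibleBridges.1 hirr
  obtain ⟨hωs, hb⟩ := mem_bridges.1 hbr
  obtain ⟨h0, -, hadj, -⟩ := mem_saws.1 hωs
  have hx0 : ω 0 0 = 0 := by rw [h0]; rfl
  have hx1 : ω 1 0 = 1 := by rw [apply_one_eq_e0_of_mem_bridges d (by norm_num) hbr]; simp
  have hx9 : ω 9 0 = 2 := by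
    have hc : costZd d 9 ω = 7 := hcost
    simp only [costZd] at hc
    have := (span_le_and_cost_bound_zd hirr).1
    have h90 : 0 < ω 9 0 := by have := (hb 9 (by norm_num) le_rfl).1; rwa [h0] at this
    omega
  have hrange : ∀ i, 1 ≤ i → i ≤ 9 → ω i 0 = 1 ∨ ω i 0 = 2 := by
    intro i hi1 hi9
    have h := hb i hi1 hi9
    rw [h0, hx9] at h
    simp only [Pi.zero_apply] at h
    omega
  -- no `+e₀, −e₀` / `−e₀, +e₀` pair, and not monotone
  have n121 : ∀ i, i + 2 ≤ 9 → ¬ (ω i 0 = 1 ∧ ω (i + 1) 0 = 2 ∧ ω (i + 2) 0 = 1) := by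
    rintro i hi ⟨e1, e2, e3⟩
    exact no_up_down_of_mem_saws d hωs hi (by rw [e1, e2]; norm_num) (by rw [e2, e3]; norm_num)
  have n212 : ∀ i, i + 2 ≤ 9 → ¬ (ω i 0 = 2 ∧ ω (i + 1) 0 = 1 ∧ ω (i + 2) 0 = 2) := by
    rintro i hi ⟨e1, e2, e3⟩
    exact no_down_up_of_mem_saws d hωs hi (by rw [e1, e2]; norm_num) (by rw [e2, e3]; norm_num)
  have nmono : ¬ (ω 1 0 ≤ ω 2 0 ∧ ω 2 0 ≤ ω 3 0 ∧ ω 3 0 ≤ ω 4 0 ∧ ω 4 0 ≤ ω 5 0 ∧ ω 5 0 ≤ ω 6 0 ∧ ω 6 0 ≤ ω 7 0 ∧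
      ω 7 0 ≤ ω 8 0 ∧ ω 8 0 ≤ ω 9 0) := by
    rintro ⟨m1, m2, m3, m4, m5, m6, m7, m8⟩
    refine not_irreducible_of_monotone d hirr (fun i hi => ?_) (by rw [hx9])
    interval_cases i
    · rw [hx0, hx1]; norm_num
    · exact m1
    · exact m2
    · exact m3
    · exact m4
    · exact m5
    · exact m6
    · exact m7
    · exact m8
  have a1 := n121 1 (by norm_num); have a2 := n121 2 (by norm_num); have a3 := n121 3 (by norm_num); have a4 := n121 4 (by norm_num)
  have a5 := n121 5 (by norm_num); have a6 := n121 6 (by norm_num); have a7 := n121 7 (by norm_num)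
  have b2 := n212 2 (by norm_num); have b3 := n212 3 (by norm_num); have b4 := n212 4 (by norm_num); have b5 := n212 5 (by norm_num)
  have b6 := n212 6 (by norm_num); have b7 := n212 7 (by norm_num)
  norm_num at a1 a2 a3 a4 a5 a6 a7 b2 b3 b4 b5 b6 b7
  obtain h2 := hrange 2 (by norm_num) (by norm_num); obtain h3 := hrange 3 (by norm_num) (by norm_num)
  obtain h4 := hrange 4 (by norm_num) (by norm_num); obtain h5 := hrange 5 (by norm_num) (by norm_num)
  obtain h6 := hrange 6 (by norm_num) (by norm_num); obtain h7 := hrange 7 (by norm_num) (by norm_num)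
  obtain h8 := hrange 8 (by norm_num) (by norm_num)
  -- the 128 height words; 108 are excluded by `a*`, `b*`, `nmono`, the 20 others give the tables
  rcases h2 with e2 | e2 <;> rcases h3 with e3 | e3 <;> rcases h4 with e4 | e4 <;> rcases h5 with e5 | e5 <;> rcases h6 with e6 | e6 <;>
    rcases h7 with e7 | e7 <;> rcases h8 with e8 | e8
  · exact (nmono ⟨by norm_num [hx1, e2], by norm_num [e2, e3], by norm_num [e3, e4], by norm_num [e4, e5], by norm_num [e5, e6], by norm_num [e6, e7], by norm_num [e7, e8], by norm_num [e8, hx9]⟩).elim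
  · exact (nmono ⟨by norm_num [hx1, e2], by norm_num [e2, e3], by norm_num [e3, e4], by norm_num [e4, e5], by norm_num [e5, e6], by norm_num [e6, e7], by norm_num [e7, e8], by norm_num [e8, hx9]⟩).elim
  · exact (a6 e6 e7 e8).elim
  · exact (nmono ⟨by norm_num [hx1, e2], by norm_num [e2, e3], by norm_num [e3, e4], by norm_num [e4, e5], by norm_num [e5, e6], by norm_num [e6, e7], by norm_num [e7, e8], by norm_num [e8, hx9]⟩).elim
  · exact (a5 e5 e6 e7).elim
  · exact (a5 e5 e6 e7).elim
  · exact (b7 e7 e8 hx9).elim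
  · exact (nmono ⟨by norm_num [hx1, e2], by norm_num [e2, e3], by norm_num [e3, e4], by norm_num [e4, e5], by norm_num [e5, e6], by norm_num [e6, e7], by norm_num [e7, e8], by norm_num [e8, hx9]⟩).elim
  · exact (a4 e4 e5 e6).elim
  · exact (a4 e4 e5 e6).elim
  · exact (a4 e4 e5 e6).elim
  · exact (a4 e4 e5 e6).elim
  · exact ⟨(4, 6, 8), by decide, heights_intro (4, 6, 8) ⟨by rw [hx0]; rfl, by rw [hx1]; rfl, by rw [e2]; rfl, by rw [e3]; rfl, by rw [e4]; rfl, by rw [e5]; rfl, by rw [e6]; rfl, by rw [e7]; rfl, by rw [e8]; rfl, by rw [hx9]; rfl⟩⟩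
  · exact (b6 e6 e7 e8).elim
  · exact (b7 e7 e8 hx9).elim
  · exact (nmono ⟨by norm_num [hx1, e2], by norm_num [e2, e3], by norm_num [e3, e4], by norm_num [e4, e5], by norm_num [e5, e6], by norm_num [e6, e7], by norm_num [e7, e8], by norm_num [e8, hx9]⟩).elim
  · exact (a3 e3 e4 e5).elim
  · exact (a3 e3 e4 e5).elim
  · exact (a3 e3 e4 e5).elim
  · exact (a3 e3 e4 e5).elim
  · exact (a3 e3 e4 e5).elim
  · exact (a3 e3 e4 e5).elim
  · exact (a3 e3 e4 e5).elim
  · exact (a3 e3 e4 e5).elim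
  · exact ⟨(3, 5, 8), by decide, heights_intro (3, 5, 8) ⟨by rw [hx0]; rfl, by rw [hx1]; rfl, by rw [e2]; rfl, by rw [e3]; rfl, by rw [e4]; rfl, by rw [e5]; rfl, by rw [e6]; rfl, by rw [e7]; rfl, by rw [e8]; rfl, by rw [hx9]; rfl⟩⟩
  · exact ⟨(3, 5, 7), by decide, heights_intro (3, 5, 7) ⟨by rw [hx0]; rfl, by rw [hx1]; rfl, by rw [e2]; rfl, by rw [e3]; rfl, by rw [e4]; rfl, by rw [e5]; rfl, by rw [e6]; rfl, by rw [e7]; rfl, by rw [e8]; rfl, by rw [hx9]; rfl⟩⟩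
  · exact (b5 e5 e6 e7).elim
  · exact (b5 e5 e6 e7).elim
  · exact ⟨(3, 6, 8), by decide, heights_intro (3, 6, 8) ⟨by rw [hx0]; rfl, by rw [hx1]; rfl, by rw [e2]; rfl, by rw [e3]; rfl, by rw [e4]; rfl, by rw [e5]; rfl, by rw [e6]; rfl, by rw [e7]; rfl, by rw [e8]; rfl, by rw [hx9]; rfl⟩⟩
  · exact (b6 e6 e7 e8).elim
  · exact (b7 e7 e8 hx9).elim
  · exact (nmono ⟨by norm_num [hx1, e2], by norm_num [e2, e3], by norm_num [e3, e4], by norm_num [e4, e5], by norm_num [e5, e6], by norm_num [e6, e7], by norm_num [e7, e8], by norm_num [e8, hx9]⟩).elim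
  · exact (a2 e2 e3 e4).elim
  · exact (a2 e2 e3 e4).elim
  · exact (a2 e2 e3 e4).elim
  · exact (a2 e2 e3 e4).elim
  · exact (a2 e2 e3 e4).elim
  · exact (a2 e2 e3 e4).elim
  · exact (a2 e2 e3 e4).elim
  · exact (a2 e2 e3 e4).elim
  · exact (a2 e2 e3 e4).elim
  · exact (a2 e2 e3 e4).elim
  · exact (a2 e2 e3 e4).elim
  · exact (a2 e2 e3 e4).elim
  · exact (a2 e2 e3 e4).elim
  · exact (a2 e2 e3 e4).elim
  · exact (a2 e2 e3 e4).elim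
  · exact (a2 e2 e3 e4).elim
  · exact ⟨(2, 4, 8), by decide, heights_intro (2, 4, 8) ⟨by rw [hx0]; rfl, by rw [hx1]; rfl, by rw [e2]; rfl, by rw [e3]; rfl, by rw [e4]; rfl, by rw [e5]; rfl, by rw [e6]; rfl, by rw [e7]; rfl, by rw [e8]; rfl, by rw [hx9]; rfl⟩⟩
  · exact ⟨(2, 4, 7), by decide, heights_intro (2, 4, 7) ⟨by rw [hx0]; rfl, by rw [hx1]; rfl, by rw [e2]; rfl, by rw [e3]; rfl, by rw [e4]; rfl, by rw [e5]; rfl, by rw [e6]; rfl, by rw [e7]; rfl, by rw [e8]; rfl, by rw [hx9]; rfl⟩⟩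
  · exact (a6 e6 e7 e8).elim
  · exact ⟨(2, 4, 6), by decide, heights_intro (2, 4, 6) ⟨by rw [hx0]; rfl, by rw [hx1]; rfl, by rw [e2]; rfl, by rw [e3]; rfl, by rw [e4]; rfl, by rw [e5]; rfl, by rw [e6]; rfl, by rw [e7]; rfl, by rw [e8]; rfl, by rw [hx9]; rfl⟩⟩
  · exact (b4 e4 e5 e6).elim
  · exact (b4 e4 e5 e6).elim
  · exact (b4 e4 e5 e6).elim
  · exact (b4 e4 e5 e6).elim
  · exact ⟨(2, 5, 8), by decide, heights_intro (2, 5, 8) ⟨by rw [hx0]; rfl, by rw [hx1]; rfl, by rw [e2]; rfl, by rw [e3]; rfl, by rw [e4]; rfl, by rw [e5]; rfl, by rw [e6]; rfl, by rw [e7]; rfl, by rw [e8]; rfl, by rw [hx9]; rfl⟩⟩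
  · exact ⟨(2, 5, 7), by decide, heights_intro (2, 5, 7) ⟨by rw [hx0]; rfl, by rw [hx1]; rfl, by rw [e2]; rfl, by rw [e3]; rfl, by rw [e4]; rfl, by rw [e5]; rfl, by rw [e6]; rfl, by rw [e7]; rfl, by rw [e8]; rfl, by rw [hx9]; rfl⟩⟩
  · exact (b5 e5 e6 e7).elim
  · exact (b5 e5 e6 e7).elim
  · exact ⟨(2, 6, 8), by decide, heights_intro (2, 6, 8) ⟨by rw [hx0]; rfl, by rw [hx1]; rfl, by rw [e2]; rfl, by rw [e3]; rfl, by rw [e4]; rfl, by rw [e5]; rfl, by rw [e6]; rfl, by rw [e7]; rfl, by rw [e8]; rfl, by rw [hx9]; rfl⟩⟩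
  · exact (b6 e6 e7 e8).elim
  · exact (b7 e7 e8 hx9).elim
  · exact (nmono ⟨by norm_num [hx1, e2], by norm_num [e2, e3], by norm_num [e3, e4], by norm_num [e4, e5], by norm_num [e5, e6], by norm_num [e6, e7], by norm_num [e7, e8], by norm_num [e8, hx9]⟩).elim
  · exact (a1 hx1 e2 e3).elim
  · exact (a1 hx1 e2 e3).elim
  · exact (a1 hx1 e2 e3).elim
  · exact (a1 hx1 e2 e3).elim
  · exact (a1 hx1 e2 e3).elim
  · exact (a1 hx1 e2 e3).elim
  · exact (a1 hx1 e2 e3).elim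
  · exact (a1 hx1 e2 e3).elim
  · exact (a1 hx1 e2 e3).elim
  · exact (a1 hx1 e2 e3).elim
  · exact (a1 hx1 e2 e3).elim
  · exact (a1 hx1 e2 e3).elim
  · exact (a1 hx1 e2 e3).elim
  · exact (a1 hx1 e2 e3).elim
  · exact (a1 hx1 e2 e3).elim
  · exact (a1 hx1 e2 e3).elim
  · exact (a1 hx1 e2 e3).elim
  · exact (a1 hx1 e2 e3).elim
  · exact (a1 hx1 e2 e3).elim
  · exact (a1 hx1 e2 e3).elim
  · exact (a1 hx1 e2 e3).elim
  · exact (a1 hx1 e2 e3).elim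
  · exact (a1 hx1 e2 e3).elim
  · exact (a1 hx1 e2 e3).elim
  · exact (a1 hx1 e2 e3).elim
  · exact (a1 hx1 e2 e3).elim
  · exact (a1 hx1 e2 e3).elim
  · exact (a1 hx1 e2 e3).elim
  · exact (a1 hx1 e2 e3).elim
  · exact (a1 hx1 e2 e3).elim
  · exact (a1 hx1 e2 e3).elim
  · exact (a1 hx1 e2 e3).elim
  · exact ⟨(1, 3, 8), by decide, heights_intro (1, 3, 8) ⟨by rw [hx0]; rfl, by rw [hx1]; rfl, by rw [e2]; rfl, by rw [e3]; rfl, by rw [e4]; rfl, by rw [e5]; rfl, by rw [e6]; rfl, by rw [e7]; rfl, by rw [e8]; rfl, by rw [hx9]; rfl⟩⟩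
  · exact ⟨(1, 3, 7), by decide, heights_intro (1, 3, 7) ⟨by rw [hx0]; rfl, by rw [hx1]; rfl, by rw [e2]; rfl, by rw [e3]; rfl, by rw [e4]; rfl, by rw [e5]; rfl, by rw [e6]; rfl, by rw [e7]; rfl, by rw [e8]; rfl, by rw [hx9]; rfl⟩⟩
  · exact (a6 e6 e7 e8).elim
  · exact ⟨(1, 3, 6), by decide, heights_intro (1, 3, 6) ⟨by rw [hx0]; rfl, by rw [hx1]; rfl, by rw [e2]; rfl, by rw [e3]; rfl, by rw [e4]; rfl, by rw [e5]; rfl, by rw [e6]; rfl, by rw [e7]; rfl, by rw [e8]; rfl, by rw [hx9]; rfl⟩⟩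
  · exact (a5 e5 e6 e7).elim
  · exact (a5 e5 e6 e7).elim
  · exact (b7 e7 e8 hx9).elim
  · exact ⟨(1, 3, 5), by decide, heights_intro (1, 3, 5) ⟨by rw [hx0]; rfl, by rw [hx1]; rfl, by rw [e2]; rfl, by rw [e3]; rfl, by rw [e4]; rfl, by rw [e5]; rfl, by rw [e6]; rfl, by rw [e7]; rfl, by rw [e8]; rfl, by rw [hx9]; rfl⟩⟩
  · exact (b3 e3 e4 e5).elim
  · exact (b3 e3 e4 e5).elim
  · exact (b3 e3 e4 e5).elim
  · exact (b3 e3 e4 e5).elim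
  · exact (b3 e3 e4 e5).elim
  · exact (b3 e3 e4 e5).elim
  · exact (b3 e3 e4 e5).elim
  · exact (b3 e3 e4 e5).elim
  · exact ⟨(1, 4, 8), by decide, heights_intro (1, 4, 8) ⟨by rw [hx0]; rfl, by rw [hx1]; rfl, by rw [e2]; rfl, by rw [e3]; rfl, by rw [e4]; rfl, by rw [e5]; rfl, by rw [e6]; rfl, by rw [e7]; rfl, by rw [e8]; rfl, by rw [hx9]; rfl⟩⟩
  · exact ⟨(1, 4, 7), by decide, heights_intro (1, 4, 7) ⟨by rw [hx0]; rfl, by rw [hx1]; rfl, by rw [e2]; rfl, by rw [e3]; rfl, by rw [e4]; rfl, by rw [e5]; rfl, by rw [e6]; rfl, by rw [e7]; rfl, by rw [e8]; rfl, by rw [hx9]; rfl⟩⟩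
  · exact (a6 e6 e7 e8).elim
  · exact ⟨(1, 4, 6), by decide, heights_intro (1, 4, 6) ⟨by rw [hx0]; rfl, by rw [hx1]; rfl, by rw [e2]; rfl, by rw [e3]; rfl, by rw [e4]; rfl, by rw [e5]; rfl, by rw [e6]; rfl, by rw [e7]; rfl, by rw [e8]; rfl, by rw [hx9]; rfl⟩⟩
  · exact (b4 e4 e5 e6).elim
  · exact (b4 e4 e5 e6).elim
  · exact (b4 e4 e5 e6).elim
  · exact (b4 e4 e5 e6).elim
  · exact ⟨(1, 5, 8), by decide, heights_intro (1, 5, 8) ⟨by rw [hx0]; rfl, by rw [hx1]; rfl, by rw [e2]; rfl, by rw [e3]; rfl, by rw [e4]; rfl, by rw [e5]; rfl, by rw [e6]; rfl, by rw [e7]; rfl, by rw [e8]; rfl, by rw [hx9]; rfl⟩⟩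
  · exact ⟨(1, 5, 7), by decide, heights_intro (1, 5, 7) ⟨by rw [hx0]; rfl, by rw [hx1]; rfl, by rw [e2]; rfl, by rw [e3]; rfl, by rw [e4]; rfl, by rw [e5]; rfl, by rw [e6]; rfl, by rw [e7]; rfl, by rw [e8]; rfl, by rw [hx9]; rfl⟩⟩
  · exact (b5 e5 e6 e7).elim
  · exact (b5 e5 e6 e7).elim
  · exact ⟨(1, 6, 8), by decide, heights_intro (1, 6, 8) ⟨by rw [hx0]; rfl, by rw [hx1]; rfl, by rw [e2]; rfl, by rw [e3]; rfl, by rw [e4]; rfl, by rw [e5]; rfl, by rw [e6]; rfl, by rw [e7]; rfl, by rw [e8]; rfl, by rw [hx9]; rfl⟩⟩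
  · exact (b6 e6 e7 e8).elim
  · exact (b7 e7 e8 hx9).elim
  · exact (nmono ⟨by norm_num [hx1, e2], by norm_num [e2, e3], by norm_num [e3, e4], by norm_num [e4, e5], by norm_num [e5, e6], by norm_num [e6, e7], by norm_num [e7, e8], by norm_num [e8, hx9]⟩).elim

/-- ★ **Every cost-seven irreducible bridge of `ℤ^{d+1}` of length nine is `walk v u`** for admissible vertical times `v` and a member
`u` of the fibre `adm v`. [cite: MadrasSlade1993, §4.2, remark after Theorem 4.2.4 (p. 94)] -/
theorem exists_params_of_mem {ω : ℕ → Site (d + 1)}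
    (hω : ω ∈ (irreducibleBridges (d + 1) 9).filter fun ω => costZd d 9 ω = 7) :
    ∃ v, IsVert v ∧ ∃ u ∈ adm d v, walk d v u = ω := by
  obtain ⟨v, hv, hH⟩ := exists_vert_of_mem hω
  obtain ⟨hirr, -⟩ := Finset.mem_filter.1 hω
  obtain ⟨hbr, -⟩ := mem_irreducibleBridges.1 hirr
  obtain ⟨hωs, -⟩ := mem_bridges.1 hbr
  obtain ⟨u, hu⟩ := exists_eq_walk_of_heights hv hωs hH
  exact ⟨v, hv, u, (mem_adm_iff hv).2 (hu ▸ hωs), hu.symm⟩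

end converse


/-! ### The layer as a disjoint union of twenty families -/

/-- The twenty admissible vertical-time triples (`1 ≤ p`, `p + 2 ≤ q`, `q + 2 ≤ r ≤ 8`). [cite: MadrasSlade1993, §4.2, remark after Theorem 4.2.4 (p. 94)] -/
def verts : Finset (ℕ × ℕ × ℕ) := ((Finset.range 9 ×ˢ (Finset.range 9 ×ˢ Finset.range 9))).filter IsVert

/-- Membership in `verts`. [cite: MadrasSlade1993, §4.2, remark after Theorem 4.2.4 (p. 94)] -/
theorem mem_verts {v : ℕ × ℕ × ℕ} : v ∈ verts ↔ IsVert v := by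
  obtain ⟨p, q, r⟩ := v
  simp only [verts, Finset.mem_filter, Finset.mem_product, Finset.mem_range, IsVert]
  omega

/-- The twenty triples, listed. [cite: MadrasSlade1993, §4.2, remark after Theorem 4.2.4 (p. 94)] -/
theorem verts_eq : verts = {(1, 3, 5), (1, 3, 6), (1, 3, 7), (1, 3, 8), (1, 4, 6), (1, 4, 7), (1, 4, 8), (1, 5, 7), (1, 5, 8), (1, 6, 8), (2, 4, 6), (2, 4, 7), (2, 4, 8), (2, 5, 7), (2, 5, 8), (2, 6, 8), (3, 5, 7), (3, 5, 8), (3, 6, 8), (4, 6, 8)} := by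
  decide

section union

variable {d : ℕ}

/-- ★ The cost-seven irreducible bridges of length nine are the disjoint union over `v ∈ verts` of the families `walk v '' adm v`.
[cite: MadrasSlade1993, §4.2, remark after Theorem 4.2.4 (p. 94)] -/
theorem layer_eq_biUnion (d : ℕ) [DecidableEq (ℕ → Site (d + 1))] :
    ((irreducibleBridges (d + 1) 9).filter fun ω => costZd d 9 ω = 7) = verts.biUnion fun v => (adm d v).image (walk d v) := by
  ext ω
  simp only [Finset.mem_biUnion, Finset.mem_image]
  constructor
  · intro h
    obtain ⟨v, hv, u, hu, rfl⟩ := exists_params_of_mem h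
    exact ⟨v, mem_verts.2 hv, u, hu, rfl⟩
  · rintro ⟨v, hv, u, hu, rfl⟩
    exact walk_mem_filter (mem_verts.1 hv) ((mem_adm_iff (mem_verts.1 hv)).1 hu)

/-- ★★ **The layer as a sum of twenty fibres**: `N_{7,9}(ℤ^{d+1}) = Σ_{v ∈ verts} #adm(v)`.
[cite: MadrasSlade1993, §4.2, remark after Theorem 4.2.4 (p. 94)] -/
theorem costCoeffZd_seven_nine_eq_sum (d : ℕ) : costCoeffZd d 7 9 = ∑ v ∈ verts, (adm d v).card := by
  classical
  rw [costCoeffZd, layer_eq_biUnion d, Finset.card_biUnion]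
  · exact Finset.sum_congr rfl fun v hv => Finset.card_image_of_injective _ (walk_injective (mem_verts.1 hv))
  · intro v hv v' hv' hne
    simp only [Function.onFun]
    rw [Finset.disjoint_left]
    intro ω hω hω'
    obtain ⟨u, -, rfl⟩ := Finset.mem_image.1 hω
    obtain ⟨u', -, h'⟩ := Finset.mem_image.1 hω'
    exact hne (verts_eq_of_eq (mem_verts.1 (Finset.mem_coe.1 hv)) (mem_verts.1 (Finset.mem_coe.1 hv')) h'.symm)

end union


/-! ### The twenty signatures: five fibre classes and their mirror images -/

/-- The signatures of the twenty vertical-time triples. [cite: MadrasSlade1993, §4.2, remark after Theorem 4.2.4 (p. 94)] -/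
theorem sig_vals :
    sig (1, 3, 5) = (true, true, true, true, true, true) ∧
    sig (1, 3, 6) = (true, true, false, true, true, true) ∧
    sig (1, 3, 7) = (true, true, true, false, true, true) ∧
    sig (1, 3, 8) = (true, true, true, true, true, true) ∧
    sig (1, 4, 6) = (true, true, true, true, true, true) ∧
    sig (1, 4, 7) = (true, false, true, false, true, true) ∧
    sig (1, 4, 8) = (true, false, true, true, true, true) ∧
    sig (1, 5, 7) = (true, true, true, true, true, true) ∧
    sig (1, 5, 8) = (true, true, false, true, true, true) ∧
    sig (1, 6, 8) = (true, true, true, true, true, true) ∧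
    sig (2, 4, 6) = (true, true, true, true, false, true) ∧
    sig (2, 4, 7) = (true, true, true, false, true, true) ∧
    sig (2, 4, 8) = (true, true, true, true, true, true) ∧
    sig (2, 5, 7) = (false, true, true, true, true, true) ∧
    sig (2, 5, 8) = (false, true, false, true, true, true) ∧
    sig (2, 6, 8) = (false, true, true, true, true, true) ∧
    sig (3, 5, 7) = (true, true, true, true, true, false) ∧
    sig (3, 5, 8) = (true, true, true, true, true, true) ∧
    sig (3, 6, 8) = (true, false, true, true, true, true) ∧
    sig (4, 6, 8) = (true, true, true, true, true, true) := by
  refine ⟨?_, ?_, ?_, ?_, ?_, ?_, ?_, ?_, ?_, ?_, ?_, ?_, ?_, ?_, ?_, ?_, ?_, ?_, ?_, ?_⟩ <;> decide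

/-- Class `A` (all six pairs: the five-step self-avoiding walks), `B` (`(3,5)` free), `C` (`(2,4)` free), `D` (`(1,5)` free),
`E` (`(1,3)` and `(3,5)` free) and the mirror classes `B'`, `C'`, `D'`, `E'`. [cite: MadrasSlade1993, §4.2, remark after Theorem 4.2.4 (p. 94)] -/
def sigA : Bool × Bool × Bool × Bool × Bool × Bool := (true, true, true, true, true, true)
/-- Class `B`. [cite: MadrasSlade1993, §4.2, remark after Theorem 4.2.4 (p. 94)] -/
def sigB : Bool × Bool × Bool × Bool × Bool × Bool := (true, true, true, false, true, true)
/-- Class `B'`. [cite: MadrasSlade1993, §4.2, remark after Theorem 4.2.4 (p. 94)] -/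
def sigB' : Bool × Bool × Bool × Bool × Bool × Bool := (false, true, true, true, true, true)
/-- Class `C`. [cite: MadrasSlade1993, §4.2, remark after Theorem 4.2.4 (p. 94)] -/
def sigC : Bool × Bool × Bool × Bool × Bool × Bool := (true, true, false, true, true, true)
/-- Class `C'`. [cite: MadrasSlade1993, §4.2, remark after Theorem 4.2.4 (p. 94)] -/
def sigC' : Bool × Bool × Bool × Bool × Bool × Bool := (true, false, true, true, true, true)
/-- Class `D`. [cite: MadrasSlade1993, §4.2, remark after Theorem 4.2.4 (p. 94)] -/
def sigD : Bool × Bool × Bool × Bool × Bool × Bool := (true, true, true, true, true, false)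
/-- Class `D'`. [cite: MadrasSlade1993, §4.2, remark after Theorem 4.2.4 (p. 94)] -/
def sigD' : Bool × Bool × Bool × Bool × Bool × Bool := (true, true, true, true, false, true)
/-- Class `E`. [cite: MadrasSlade1993, §4.2, remark after Theorem 4.2.4 (p. 94)] -/
def sigE : Bool × Bool × Bool × Bool × Bool × Bool := (true, false, true, false, true, true)
/-- Class `E'`. [cite: MadrasSlade1993, §4.2, remark after Theorem 4.2.4 (p. 94)] -/
def sigE' : Bool × Bool × Bool × Bool × Bool × Bool := (false, true, false, true, true, true)

/-- ★ The sum over the twenty fibres collected by class: `8A + 2B + 2B' + 2C + 2C' + D + D' + E + E'`.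
[cite: MadrasSlade1993, §4.2, remark after Theorem 4.2.4 (p. 94)] -/
theorem sum_card_adm (d : ℕ) : ∑ v ∈ verts, (adm d v).card =
    8 * (admSig d sigA).card + 2 * (admSig d sigB).card + 2 * (admSig d sigB').card + 2 * (admSig d sigC).card +
      2 * (admSig d sigC').card + (admSig d sigD).card + (admSig d sigD').card + (admSig d sigE).card + (admSig d sigE').card := by
  obtain ⟨s1, s2, s3, s4, s5, s6, s7, s8, s9, s10, s11, s12, s13, s14, s15, s16, s17, s18, s19, s20⟩ := sig_vals
  simp only [sigA, sigB, sigB', sigC, sigC', sigD, sigD', sigE, sigE', adm]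
  rw [verts_eq, Finset.sum_insert (by decide), Finset.sum_insert (by decide), Finset.sum_insert (by decide), Finset.sum_insert (by decide), Finset.sum_insert (by decide), Finset.sum_insert (by decide), Finset.sum_insert (by decide), Finset.sum_insert (by decide), Finset.sum_insert (by decide), Finset.sum_insert (by decide), Finset.sum_insert (by decide), Finset.sum_insert (by decide), Finset.sum_insert (by decide), Finset.sum_insert (by decide), Finset.sum_insert (by decide), Finset.sum_insert (by decide), Finset.sum_insert (by decide), Finset.sum_insert (by decide), Finset.sum_insert (by decide), Finset.sum_singleton,
    s1, s2, s3, s4, s5, s6, s7, s8, s9, s10, s11, s12, s13, s14, s15, s16, s17, s18, s19, s20]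
  ring


/-! ### The five fibre counts -/

section fibres

variable (d : ℕ)

/-- Unfolding `GoodSig` at a literal signature. [cite: MadrasSlade1993, §4.2, remark after Theorem 4.2.4 (p. 94)] -/
theorem mem_admSig_iff {σ : Bool × Bool × Bool × Bool × Bool × Bool} {u : Idx5 d} : u ∈ admSig d σ ↔ GoodSig d σ u := by
  rw [admSig, Finset.mem_filter]; simp

/-- Class `A` is the index set of the five-step self-avoiding walks. [cite: MadrasSlade1993, §4.2, remark after Theorem 4.2.4 (p. 94)] -/
theorem admSig_A_eq : admSig d sigA = sixStepIndex d := by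
  ext ⟨a, b, c, e, f⟩
  rw [mem_admSig_iff, mem_sixStepIndex]
  simp only [sigA, GoodSig, true_implies]
  constructor
  · rintro ⟨h1, h2, h3, h4, h5, h6⟩
    refine ⟨⟨h1, h2, h3, h4⟩, ?_, ?_⟩
    · rintro ⟨hca, heb⟩; apply h5; rw [hca, heb, twoStepV_revIdx, twoStepV_revIdx]; abel
    · rintro ⟨heb, hfc⟩; apply h6; rw [heb, hfc, twoStepV_revIdx, twoStepV_revIdx]; abel
  · rintro ⟨⟨h1, h2, h3, h4⟩, h5, h6⟩
    refine ⟨h1, h2, h3, h4, fun hs => ?_, fun hs => ?_⟩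
    · rcases (sum_four_eq_zero_iff d a b c e).1 hs with ⟨hba, -⟩ | ⟨hca, heb⟩ | ⟨-, hcb⟩
      · exact h1 hba
      · exact h5 ⟨hca, heb⟩
      · exact h2 hcb
    · rcases (sum_four_eq_zero_iff d b c e f).1 hs with ⟨hcb, -⟩ | ⟨heb, hfc⟩ | ⟨-, hec⟩
      · exact h2 hcb
      · exact h6 ⟨heb, hfc⟩
      · exact h3 hec

/-- `#A + 2d(2d−2)(4d−3) = 2d(2d−1)⁴` (`#A = c₅(ℤ^d)`). [cite: MadrasSlade1993, §4.2, remark after Theorem 4.2.4 (p. 94)] -/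
theorem card_admSig_A_add : (admSig d sigA).card + 2 * d * (2 * d - 2) * (4 * d - 3) = 2 * d * (2 * d - 1) ^ 4 := by
  rw [admSig_A_eq, card_sixStepIndex_add]

/-- Class `D` is `nonrevFive ∖ squareA` (no condition on the pair `(1, 5)`). [cite: MadrasSlade1993, §4.2, remark after Theorem 4.2.4 (p. 94)] -/
theorem admSig_D_eq : admSig d sigD = nonrevFive d \ squareA d := by
  ext ⟨a, b, c, e, f⟩
  rw [mem_admSig_iff, Finset.mem_sdiff]
  simp only [sigD, GoodSig, true_implies, Bool.false_eq_true, false_implies, and_true, nonrevFive, squareA, Finset.mem_filter,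
    Finset.mem_univ, true_and]
  constructor
  · rintro ⟨h1, h2, h3, h4, h5⟩
    refine ⟨⟨h1, h2, h3, h4⟩, ?_⟩
    rintro ⟨-, hca, heb⟩; apply h5; rw [hca, heb, twoStepV_revIdx, twoStepV_revIdx]; abel
  · rintro ⟨⟨h1, h2, h3, h4⟩, h5⟩
    refine ⟨h1, h2, h3, h4, fun hs => ?_⟩
    rcases (sum_four_eq_zero_iff d a b c e).1 hs with ⟨hba, -⟩ | ⟨hca, heb⟩ | ⟨-, hcb⟩
    · exact h1 hba
    · exact h5 ⟨⟨h1, h2, h3, h4⟩, hca, heb⟩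
    · exact h2 hcb

/-- `#D + 2d(2d−2)(2d−1) = 2d(2d−1)⁴`. [cite: MadrasSlade1993, §4.2, remark after Theorem 4.2.4 (p. 94)] -/
theorem card_admSig_D_add : (admSig d sigD).card + 2 * d * (2 * d - 2) * (2 * d - 1) = 2 * d * (2 * d - 1) ^ 4 := by
  have hsub : squareA d ⊆ nonrevFive d := Finset.filter_subset _ _
  have hle := Finset.card_le_card hsub
  rw [admSig_D_eq, Finset.card_sdiff_of_subset hsub, card_nonrevFive, card_squareA]
  rw [card_nonrevFive, card_squareA] at hle
  exact Nat.sub_add_cancel hle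

/-- Class `B` unfolded: `b ≠ −a`, `c ≠ −b`, `e ≠ −c`, no square on steps `1–4`, no square on steps `2–5` (`f` free otherwise).
[cite: MadrasSlade1993, §4.2, remark after Theorem 4.2.4 (p. 94)] -/
theorem admSig_B_eq : admSig d sigB = Finset.univ.filter fun t : Idx5 d => t.2.1 ≠ revIdx t.1 ∧ (t.2.2.1 ≠ revIdx t.2.1 ∧
    ((t.2.2.2.1 ≠ revIdx t.2.2.1 ∧ ¬ (t.2.2.1 = revIdx t.1 ∧ t.2.2.2.1 = revIdx t.2.1)) ∧
      ¬ (t.2.2.2.1 = revIdx t.2.1 ∧ t.2.2.2.2 = revIdx t.2.2.1))) := by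
  ext ⟨a, b, c, e, f⟩
  rw [mem_admSig_iff, Finset.mem_filter]
  simp only [sigB, GoodSig, true_implies, Bool.false_eq_true, false_implies, true_and, Finset.mem_univ]
  constructor
  · rintro ⟨h1, h2, h3, h5, h6⟩
    refine ⟨h1, h2, ⟨h3, ?_⟩, ?_⟩
    · rintro ⟨hca, heb⟩; apply h5; rw [hca, heb, twoStepV_revIdx, twoStepV_revIdx]; abel
    · rintro ⟨heb, hfc⟩; apply h6; rw [heb, hfc, twoStepV_revIdx, twoStepV_revIdx]; abel
  · rintro ⟨h1, h2, ⟨h3, h5⟩, h6⟩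
    refine ⟨h1, h2, h3, fun hs => ?_, fun hs => ?_⟩
    · rcases (sum_four_eq_zero_iff d a b c e).1 hs with ⟨hba, -⟩ | ⟨hca, heb⟩ | ⟨-, hcb⟩
      · exact h1 hba
      · exact h5 ⟨hca, heb⟩
      · exact h2 hcb
    · rcases (sum_four_eq_zero_iff d b c e f).1 hs with ⟨hcb, -⟩ | ⟨heb, hfc⟩ | ⟨-, hec⟩
      · exact h2 hcb
      · exact h6 ⟨heb, hfc⟩
      · exact h3 hec

/-- `#B = 2d·(T₌ + (2d−2)·T_≠)` by iterated counting (`b = a` resp. `b ∉ {a, −a}`; then `c = −a`, `c = b`, or else; then `e = −b` or else).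
[cite: MadrasSlade1993, §4.2, remark after Theorem 4.2.4 (p. 94)] -/
theorem card_admSig_B : (admSig d sigB).card = 2 * d *
    (((2 * d - 1) * (2 * d) + (2 * d - 2) * ((2 * d - 1) + (2 * d - 2) * (2 * d))) +
      (2 * d - 2) * ((2 * d - 2) * (2 * d) + (2 * d - 1) * (2 * d) + (2 * d - 3) * ((2 * d - 1) + (2 * d - 2) * (2 * d)))) := by
  classical
  have hU : (Finset.univ : Finset (Idx d)).card = 2 * d := by rw [Finset.card_univ, card_idx]
  -- level `f`
  have hF : ∀ b c e : Idx d, (Finset.univ.filter fun f : Idx d => ¬ (e = revIdx b ∧ f = revIdx c)).card =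
      if e = revIdx b then 2 * d - 1 else 2 * d := by
    intro b c e
    by_cases he : e = revIdx b
    · rw [if_pos he, Finset.filter_congr (q := fun f : Idx d => f ≠ revIdx c) fun f _ => by simp [he]]
      exact card_filter_ne_idx d (revIdx c)
    · rw [if_neg he, Finset.filter_eq_self.2 (fun f _ => by simp [he]), hU]
  -- level `e`
  have hE : ∀ a b c : Idx d, b ≠ revIdx a → c ≠ revIdx b →
      (Finset.univ.filter fun t : Idx d × Idx d => (t.1 ≠ revIdx c ∧ ¬ (c = revIdx a ∧ t.1 = revIdx b)) ∧
        ¬ (t.1 = revIdx b ∧ t.2 = revIdx c)).card =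
        if c = revIdx a then (2 * d - 2) * (2 * d) else if c = b then (2 * d - 1) * (2 * d) else (2 * d - 1) + (2 * d - 2) * (2 * d) := by
    intro a b c hab hbc
    rw [card_filter_univ_prod]
    simp only [card_filter_const_and]
    by_cases hca : c = revIdx a
    · rw [if_pos hca]
      have hcb' : revIdx c ≠ revIdx b := by rw [hca, revIdx_revIdx]; exact ne_revIdx_symm hab
      have step : ∀ e : Idx d, (if (e ≠ revIdx c ∧ ¬ (c = revIdx a ∧ e = revIdx b)) then
          (Finset.univ.filter fun f : Idx d => ¬ (e = revIdx b ∧ f = revIdx c)).card else 0) =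
          if (e ≠ revIdx c ∧ e ≠ revIdx b) then 2 * d else 0 := by
        intro e
        by_cases h : (e ≠ revIdx c ∧ e ≠ revIdx b)
        · rw [if_pos h, if_pos ⟨h.1, fun hh => h.2 hh.2⟩, hF, if_neg h.2]
        · rw [if_neg h, if_neg (fun h' => h ⟨h'.1, fun hh => h'.2 ⟨hca, hh⟩⟩)]
      rw [Finset.sum_congr rfl fun e _ => step e, sum_ite_const_nat, card_filter_ne_ne_idx d hcb']
    · rw [if_neg hca]
      by_cases hcb : c = b
      · rw [if_pos hcb]
        have step : ∀ e : Idx d, (if (e ≠ revIdx c ∧ ¬ (c = revIdx a ∧ e = revIdx b)) then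
            (Finset.univ.filter fun f : Idx d => ¬ (e = revIdx b ∧ f = revIdx c)).card else 0) =
            if e ≠ revIdx c then 2 * d else 0 := by
          intro e
          by_cases h : e ≠ revIdx c
          · rw [if_pos h, if_pos ⟨h, fun hh => hca hh.1⟩, hF, if_neg (by rw [← hcb]; exact h)]
          · rw [if_neg h, if_neg (fun h' => h h'.1)]
        rw [Finset.sum_congr rfl fun e _ => step e, sum_ite_const_nat, card_filter_ne_idx]
      · rw [if_neg hcb]
        have hbc' : revIdx b ≠ revIdx c := fun h => hcb (revIdx_inj h).symm
        have step : ∀ e : Idx d, (if (e ≠ revIdx c ∧ ¬ (c = revIdx a ∧ e = revIdx b)) then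
            (Finset.univ.filter fun f : Idx d => ¬ (e = revIdx b ∧ f = revIdx c)).card else 0) =
            (if e = revIdx b then 2 * d - 1 else 0) + (if (e ≠ revIdx c ∧ e ≠ revIdx b) then 2 * d else 0) := by
          intro e
          by_cases heb : e = revIdx b
          · rw [if_pos ⟨by rw [heb]; exact hbc', fun hh => hca hh.1⟩, hF, if_pos heb, if_pos heb, if_neg (fun h => h.2 heb), add_zero]
          · rw [if_neg heb, zero_add]
            by_cases hec : e ≠ revIdx c
            · rw [if_pos ⟨hec, fun hh => hca hh.1⟩, hF, if_neg heb, if_pos ⟨hec, heb⟩]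
            · rw [if_neg (fun h => hec h.1), if_neg (fun h => hec h.1)]
        rw [Finset.sum_congr rfl fun e _ => step e, Finset.sum_add_distrib, Finset.sum_ite_eq' Finset.univ (revIdx b),
          if_pos (Finset.mem_univ _), sum_ite_const_nat, card_filter_ne_ne_idx d hbc'.symm]
  -- level `c`
  have hC : ∀ a b : Idx d, b ≠ revIdx a →
      (Finset.univ.filter fun t : Idx d × Idx d × Idx d => t.1 ≠ revIdx b ∧ ((t.2.1 ≠ revIdx t.1 ∧ ¬ (t.1 = revIdx a ∧ t.2.1 = revIdx b)) ∧
        ¬ (t.2.1 = revIdx b ∧ t.2.2 = revIdx t.1))).card =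
        if b = a then (2 * d - 1) * (2 * d) + (2 * d - 2) * ((2 * d - 1) + (2 * d - 2) * (2 * d))
        else (2 * d - 2) * (2 * d) + (2 * d - 1) * (2 * d) + (2 * d - 3) * ((2 * d - 1) + (2 * d - 2) * (2 * d)) := by
    intro a b hab
    rw [card_filter_univ_prod]
    simp only [card_filter_const_and]
    have hbb : revIdx b ≠ b := revIdx_ne_self b
    by_cases hba : b = a
    · rw [if_pos hba]
      have step : ∀ c : Idx d, (if c ≠ revIdx b then (Finset.univ.filter fun t : Idx d × Idx d =>
          (t.1 ≠ revIdx c ∧ ¬ (c = revIdx a ∧ t.1 = revIdx b)) ∧ ¬ (t.1 = revIdx b ∧ t.2 = revIdx c)).card else 0) =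
          (if c = b then (2 * d - 1) * (2 * d) else 0) + (if (c ≠ revIdx b ∧ c ≠ b) then (2 * d - 1) + (2 * d - 2) * (2 * d) else 0) := by
        intro c
        by_cases hcb : c ≠ revIdx b
        · have hca : c ≠ revIdx a := by rw [← hba]; exact hcb
          rw [if_pos hcb, hE a b c hab hcb, if_neg hca]
          by_cases hcb2 : c = b
          · rw [if_pos hcb2, if_pos hcb2, if_neg (fun h => h.2 hcb2), add_zero]
          · rw [if_neg hcb2, if_neg hcb2, if_pos ⟨hcb, hcb2⟩, zero_add]
        · rw [if_neg hcb, if_neg (fun h => hcb (by rw [h]; exact hbb.symm)), if_neg (fun h => hcb h.1)]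
      rw [Finset.sum_congr rfl fun c _ => step c, Finset.sum_add_distrib, Finset.sum_ite_eq' Finset.univ b, if_pos (Finset.mem_univ _),
        sum_ite_const_nat, card_filter_ne_ne_idx d hbb]
    · rw [if_neg hba]
      have hab' : revIdx b ≠ revIdx a := fun h => hba (revIdx_inj h)
      have hab'' : revIdx a ≠ b := fun h => hab h.symm
      have step : ∀ c : Idx d, (if c ≠ revIdx b then (Finset.univ.filter fun t : Idx d × Idx d =>
          (t.1 ≠ revIdx c ∧ ¬ (c = revIdx a ∧ t.1 = revIdx b)) ∧ ¬ (t.1 = revIdx b ∧ t.2 = revIdx c)).card else 0) =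
          (if c = revIdx a then (2 * d - 2) * (2 * d) else 0) + (if c = b then (2 * d - 1) * (2 * d) else 0) +
            (if (c ≠ revIdx b ∧ c ≠ revIdx a ∧ c ≠ b) then (2 * d - 1) + (2 * d - 2) * (2 * d) else 0) := by
        intro c
        by_cases hcb : c ≠ revIdx b
        · rw [if_pos hcb, hE a b c hab hcb]
          by_cases hca : c = revIdx a
          · rw [if_pos hca, if_pos hca, if_neg (by rw [hca]; exact hab''), if_neg (fun h => h.2.1 hca), add_zero, add_zero]
          · rw [if_neg hca, if_neg hca, zero_add]
            by_cases hcb2 : c = b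
            · rw [if_pos hcb2, if_pos hcb2, if_neg (fun h => h.2.2 hcb2), add_zero]
            · rw [if_neg hcb2, if_neg hcb2, if_pos ⟨hcb, hca, hcb2⟩, zero_add]
        · have hc : c = revIdx b := not_not.1 hcb
          rw [if_neg hcb, if_neg (by rw [hc]; exact hab'), if_neg (by rw [hc]; exact hbb), if_neg (fun h => hcb h.1)]
      rw [Finset.sum_congr rfl fun c _ => step c, Finset.sum_add_distrib, Finset.sum_add_distrib,
        Finset.sum_ite_eq' Finset.univ (revIdx a), if_pos (Finset.mem_univ _), Finset.sum_ite_eq' Finset.univ b, if_pos (Finset.mem_univ _),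
        sum_ite_const_nat, card_filter_ne_three_idx d hab' hbb hab'']
  -- level `b`
  have hB : ∀ a : Idx d, (Finset.univ.filter fun t : Idx d × Idx d × Idx d × Idx d => t.1 ≠ revIdx a ∧ (t.2.1 ≠ revIdx t.1 ∧
      ((t.2.2.1 ≠ revIdx t.2.1 ∧ ¬ (t.2.1 = revIdx a ∧ t.2.2.1 = revIdx t.1)) ∧ ¬ (t.2.2.1 = revIdx t.1 ∧ t.2.2.2 = revIdx t.2.1)))).card =
      ((2 * d - 1) * (2 * d) + (2 * d - 2) * ((2 * d - 1) + (2 * d - 2) * (2 * d))) +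
        (2 * d - 2) * ((2 * d - 2) * (2 * d) + (2 * d - 1) * (2 * d) + (2 * d - 3) * ((2 * d - 1) + (2 * d - 2) * (2 * d))) := by
    intro a
    rw [card_filter_univ_prod]
    simp only [card_filter_const_and]
    have haa : a ≠ revIdx a := (revIdx_ne_self a).symm
    have step : ∀ b : Idx d, (if b ≠ revIdx a then (Finset.univ.filter fun t : Idx d × Idx d × Idx d => t.1 ≠ revIdx b ∧
        ((t.2.1 ≠ revIdx t.1 ∧ ¬ (t.1 = revIdx a ∧ t.2.1 = revIdx b)) ∧ ¬ (t.2.1 = revIdx b ∧ t.2.2 = revIdx t.1))).card else 0) =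
        (if b = a then (2 * d - 1) * (2 * d) + (2 * d - 2) * ((2 * d - 1) + (2 * d - 2) * (2 * d)) else 0) +
          (if (b ≠ revIdx a ∧ b ≠ a) then
            (2 * d - 2) * (2 * d) + (2 * d - 1) * (2 * d) + (2 * d - 3) * ((2 * d - 1) + (2 * d - 2) * (2 * d)) else 0) := by
      intro b
      by_cases hba : b ≠ revIdx a
      · rw [if_pos hba, hC a b hba]
        by_cases hba2 : b = a
        · rw [if_pos hba2, if_pos hba2, if_neg (fun h => h.2 hba2), add_zero]
        · rw [if_neg hba2, if_neg hba2, if_pos ⟨hba, hba2⟩, zero_add]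
      · rw [if_neg hba, if_neg (fun h => hba (by rw [h]; exact haa)), if_neg (fun h => hba h.1)]
    rw [Finset.sum_congr rfl fun b _ => step b, Finset.sum_add_distrib, Finset.sum_ite_eq' Finset.univ a, if_pos (Finset.mem_univ _),
      sum_ite_const_nat, card_filter_ne_ne_idx d haa.symm]
  rw [admSig_B_eq, card_filter_univ_prod]
  simp only [hB]
  rw [Finset.sum_const, smul_eq_mul, hU]

/-- Class `C` unfolded: `b ≠ −a`, `c ≠ −b`, no square on steps `1–4`, `f ≠ −e`, and the two admissible cancellations of `b+c+e+f`
excluded (`e` free with respect to `c`). [cite: MadrasSlade1993, §4.2, remark after Theorem 4.2.4 (p. 94)] -/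
theorem admSig_C_eq : admSig d sigC = Finset.univ.filter fun t : Idx5 d => t.2.1 ≠ revIdx t.1 ∧ (t.2.2.1 ≠ revIdx t.2.1 ∧
    (¬ (t.2.2.1 = revIdx t.1 ∧ t.2.2.2.1 = revIdx t.2.1) ∧ (t.2.2.2.2 ≠ revIdx t.2.2.2.1 ∧
      ¬ (t.2.2.2.1 = revIdx t.2.1 ∧ t.2.2.2.2 = revIdx t.2.2.1) ∧ ¬ (t.2.2.2.2 = revIdx t.2.1 ∧ t.2.2.2.1 = revIdx t.2.2.1)))) := by
  ext ⟨a, b, c, e, f⟩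
  rw [mem_admSig_iff, Finset.mem_filter]
  simp only [sigC, GoodSig, true_implies, Bool.false_eq_true, false_implies, true_and, Finset.mem_univ]
  constructor
  · rintro ⟨h1, h2, h4, h5, h6⟩
    refine ⟨h1, h2, ?_, h4, ?_, ?_⟩
    · rintro ⟨hca, heb⟩; apply h5; rw [hca, heb, twoStepV_revIdx, twoStepV_revIdx]; abel
    · rintro ⟨heb, hfc⟩; apply h6; rw [heb, hfc, twoStepV_revIdx, twoStepV_revIdx]; abel
    · rintro ⟨hfb, hec⟩; apply h6; rw [hfb, hec, twoStepV_revIdx, twoStepV_revIdx]; abel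
  · rintro ⟨h1, h2, h5, h4, h6, h7⟩
    refine ⟨h1, h2, h4, fun hs => ?_, fun hs => ?_⟩
    · rcases (sum_four_eq_zero_iff d a b c e).1 hs with ⟨hba, -⟩ | ⟨hca, heb⟩ | ⟨-, hcb⟩
      · exact h1 hba
      · exact h5 ⟨hca, heb⟩
      · exact h2 hcb
    · rcases (sum_four_eq_zero_iff d b c e f).1 hs with ⟨hcb, -⟩ | ⟨heb, hfc⟩ | ⟨hfb, hec⟩
      · exact h2 hcb
      · exact h6 ⟨heb, hfc⟩
      · exact h7 ⟨hfb, hec⟩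

/-- `#C = 2d·(T₌ + (2d−2)·T_≠)` by iterated counting. [cite: MadrasSlade1993, §4.2, remark after Theorem 4.2.4 (p. 94)] -/
theorem card_admSig_C : (admSig d sigC).card = 2 * d *
    ((((2 * d - 2) + (2 * d - 1) * (2 * d - 1)) + (2 * d - 2) * (2 * (2 * d - 2) + (2 * d - 2) * (2 * d - 1))) +
      (2 * d - 2) * (((2 * d - 2) + (2 * d - 2) * (2 * d - 1)) + ((2 * d - 2) + (2 * d - 1) * (2 * d - 1)) +
        (2 * d - 3) * (2 * (2 * d - 2) + (2 * d - 2) * (2 * d - 1)))) := by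
  classical
  have hU : (Finset.univ : Finset (Idx d)).card = 2 * d := by rw [Finset.card_univ, card_idx]
  -- level `f`
  have hF : ∀ b c e : Idx d, c ≠ revIdx b →
      (Finset.univ.filter fun f : Idx d => f ≠ revIdx e ∧ ¬ (e = revIdx b ∧ f = revIdx c) ∧ ¬ (f = revIdx b ∧ e = revIdx c)).card =
        if (e = revIdx b ∨ e = revIdx c) then 2 * d - 2 else 2 * d - 1 := by
    intro b c e hcb
    by_cases heb : e = revIdx b
    · rw [if_pos (Or.inl heb)]
      have hec : revIdx e ≠ revIdx c := by rw [heb, revIdx_revIdx]; exact ne_revIdx_symm hcb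
      rw [Finset.filter_congr (q := fun f : Idx d => f ≠ revIdx e ∧ f ≠ revIdx c) fun f _ => by
        constructor
        · rintro ⟨h1, h2, -⟩; exact ⟨h1, fun hf => h2 ⟨heb, hf⟩⟩
        · rintro ⟨h1, h2⟩
          refine ⟨h1, fun hh => h2 hh.2, fun hh => ?_⟩
          have hbc : b = c := revIdx_inj (heb.symm.trans hh.2)
          exact h2 (by rw [hh.1, hbc])]
      exact card_filter_ne_ne_idx d hec
    · by_cases hec : e = revIdx c
      · rw [if_pos (Or.inr hec)]
        have heb' : revIdx e ≠ revIdx b := by rw [hec, revIdx_revIdx]; exact hcb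
        rw [Finset.filter_congr (q := fun f : Idx d => f ≠ revIdx e ∧ f ≠ revIdx b) fun f _ => by
          constructor
          · rintro ⟨h1, -, h3⟩; exact ⟨h1, fun hf => h3 ⟨hf, hec⟩⟩
          · rintro ⟨h1, h3⟩; exact ⟨h1, fun hh => heb hh.1, fun hh => h3 hh.1⟩]
        exact card_filter_ne_ne_idx d heb'
      · rw [if_neg (not_or.2 ⟨heb, hec⟩), Finset.filter_congr (q := fun f : Idx d => f ≠ revIdx e) fun f _ => by
          constructor
          · rintro ⟨h1, -, -⟩; exact h1
          · intro h1; exact ⟨h1, fun hh => heb hh.1, fun hh => hec hh.2⟩]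
        exact card_filter_ne_idx d (revIdx e)
  -- level `e`
  have hE : ∀ a b c : Idx d, b ≠ revIdx a → c ≠ revIdx b →
      (Finset.univ.filter fun t : Idx d × Idx d => ¬ (c = revIdx a ∧ t.1 = revIdx b) ∧
        (t.2 ≠ revIdx t.1 ∧ ¬ (t.1 = revIdx b ∧ t.2 = revIdx c) ∧ ¬ (t.2 = revIdx b ∧ t.1 = revIdx c))).card =
        if c = revIdx a then (2 * d - 2) + (2 * d - 2) * (2 * d - 1)
        else if c = b then (2 * d - 2) + (2 * d - 1) * (2 * d - 1) else 2 * (2 * d - 2) + (2 * d - 2) * (2 * d - 1) := by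
    intro a b c hab hbc
    rw [card_filter_univ_prod]
    simp only [card_filter_const_and]
    by_cases hca : c = revIdx a
    · rw [if_pos hca]
      have hcb' : revIdx b ≠ revIdx c := by rw [hca, revIdx_revIdx]; exact fun h => hab (by rw [← h, revIdx_revIdx])
      have step : ∀ e : Idx d, (if ¬ (c = revIdx a ∧ e = revIdx b) then (Finset.univ.filter fun f : Idx d =>
          f ≠ revIdx e ∧ ¬ (e = revIdx b ∧ f = revIdx c) ∧ ¬ (f = revIdx b ∧ e = revIdx c)).card else 0) =
          (if e = revIdx c then 2 * d - 2 else 0) + (if (e ≠ revIdx b ∧ e ≠ revIdx c) then 2 * d - 1 else 0) := by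
        intro e
        by_cases heb : e = revIdx b
        · rw [if_neg (not_not.2 ⟨hca, heb⟩), if_neg (by rw [heb]; exact hcb'), if_neg (fun h => h.1 heb)]
        · rw [if_pos (fun h => heb h.2), hF b c e hbc]
          by_cases hec : e = revIdx c
          · rw [if_pos (Or.inr hec), if_pos hec, if_neg (fun h => h.2 hec), add_zero]
          · rw [if_neg (not_or.2 ⟨heb, hec⟩), if_neg hec, if_pos ⟨heb, hec⟩, zero_add]
      rw [Finset.sum_congr rfl fun e _ => step e, Finset.sum_add_distrib, Finset.sum_ite_eq' Finset.univ (revIdx c),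
        if_pos (Finset.mem_univ _), sum_ite_const_nat, card_filter_ne_ne_idx d hcb']
    · rw [if_neg hca]
      have step0 : ∀ e : Idx d, (if ¬ (c = revIdx a ∧ e = revIdx b) then (Finset.univ.filter fun f : Idx d =>
          f ≠ revIdx e ∧ ¬ (e = revIdx b ∧ f = revIdx c) ∧ ¬ (f = revIdx b ∧ e = revIdx c)).card else 0) =
          (if (e = revIdx b ∨ e = revIdx c) then 2 * d - 2 else 0) + (if ¬ (e = revIdx b ∨ e = revIdx c) then 2 * d - 1 else 0) := by
        intro e
        rw [if_pos (fun h => hca h.1), hF b c e hbc]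
        by_cases h : (e = revIdx b ∨ e = revIdx c)
        · rw [if_pos h, if_pos h, if_neg (not_not.2 h), add_zero]
        · rw [if_neg h, if_neg h, if_pos h, zero_add]
      rw [Finset.sum_congr rfl fun e _ => step0 e, Finset.sum_add_distrib, sum_ite_const_nat, sum_ite_const_nat]
      by_cases hcb : c = b
      · rw [if_pos hcb]
        subst hcb
        rw [Finset.filter_congr (q := fun e : Idx d => e = revIdx c) fun e _ => by simp,
          Finset.filter_eq' Finset.univ (revIdx c), if_pos (Finset.mem_univ _), Finset.card_singleton, one_mul,
          Finset.filter_congr (q := fun e : Idx d => e ≠ revIdx c) fun e _ => by simp, card_filter_ne_idx]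
      · rw [if_neg hcb]
        have hbc' : revIdx b ≠ revIdx c := fun h => hcb (revIdx_inj h).symm
        have hpair : (Finset.univ.filter fun e : Idx d => e = revIdx b ∨ e = revIdx c) = {revIdx b, revIdx c} := by
          ext e; simp
        rw [hpair, Finset.card_pair hbc', Finset.filter_congr (q := fun e : Idx d => e ≠ revIdx b ∧ e ≠ revIdx c) fun e _ => by
          rw [not_or], card_filter_ne_ne_idx d hbc']
  -- level `c`
  have hC : ∀ a b : Idx d, b ≠ revIdx a →
      (Finset.univ.filter fun t : Idx d × Idx d × Idx d => t.1 ≠ revIdx b ∧ (¬ (t.1 = revIdx a ∧ t.2.1 = revIdx b) ∧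
        (t.2.2 ≠ revIdx t.2.1 ∧ ¬ (t.2.1 = revIdx b ∧ t.2.2 = revIdx t.1) ∧ ¬ (t.2.2 = revIdx b ∧ t.2.1 = revIdx t.1)))).card =
        if b = a then ((2 * d - 2) + (2 * d - 1) * (2 * d - 1)) + (2 * d - 2) * (2 * (2 * d - 2) + (2 * d - 2) * (2 * d - 1))
        else ((2 * d - 2) + (2 * d - 2) * (2 * d - 1)) + ((2 * d - 2) + (2 * d - 1) * (2 * d - 1)) +
          (2 * d - 3) * (2 * (2 * d - 2) + (2 * d - 2) * (2 * d - 1)) := by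
    intro a b hab
    rw [card_filter_univ_prod]
    simp only [card_filter_const_and]
    have hbb : revIdx b ≠ b := revIdx_ne_self b
    by_cases hba : b = a
    · rw [if_pos hba]
      have step : ∀ c : Idx d, (if c ≠ revIdx b then (Finset.univ.filter fun t : Idx d × Idx d =>
          ¬ (c = revIdx a ∧ t.1 = revIdx b) ∧ (t.2 ≠ revIdx t.1 ∧ ¬ (t.1 = revIdx b ∧ t.2 = revIdx c) ∧ ¬ (t.2 = revIdx b ∧ t.1 = revIdx c))).card
          else 0) =
          (if c = b then (2 * d - 2) + (2 * d - 1) * (2 * d - 1) else 0) +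
            (if (c ≠ revIdx b ∧ c ≠ b) then 2 * (2 * d - 2) + (2 * d - 2) * (2 * d - 1) else 0) := by
        intro c
        by_cases hcb : c ≠ revIdx b
        · have hca : c ≠ revIdx a := by rw [← hba]; exact hcb
          rw [if_pos hcb, hE a b c hab hcb, if_neg hca]
          by_cases hcb2 : c = b
          · rw [if_pos hcb2, if_pos hcb2, if_neg (fun h => h.2 hcb2), add_zero]
          · rw [if_neg hcb2, if_neg hcb2, if_pos ⟨hcb, hcb2⟩, zero_add]
        · rw [if_neg hcb, if_neg (fun h => hcb (by rw [h]; exact hbb.symm)), if_neg (fun h => hcb h.1)]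
      rw [Finset.sum_congr rfl fun c _ => step c, Finset.sum_add_distrib, Finset.sum_ite_eq' Finset.univ b, if_pos (Finset.mem_univ _),
        sum_ite_const_nat, card_filter_ne_ne_idx d hbb]
    · rw [if_neg hba]
      have hab' : revIdx b ≠ revIdx a := fun h => hba (revIdx_inj h)
      have hab'' : revIdx a ≠ b := fun h => hab h.symm
      have step : ∀ c : Idx d, (if c ≠ revIdx b then (Finset.univ.filter fun t : Idx d × Idx d =>
          ¬ (c = revIdx a ∧ t.1 = revIdx b) ∧ (t.2 ≠ revIdx t.1 ∧ ¬ (t.1 = revIdx b ∧ t.2 = revIdx c) ∧ ¬ (t.2 = revIdx b ∧ t.1 = revIdx c))).card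
          else 0) =
          (if c = revIdx a then (2 * d - 2) + (2 * d - 2) * (2 * d - 1) else 0) +
            (if c = b then (2 * d - 2) + (2 * d - 1) * (2 * d - 1) else 0) +
            (if (c ≠ revIdx b ∧ c ≠ revIdx a ∧ c ≠ b) then 2 * (2 * d - 2) + (2 * d - 2) * (2 * d - 1) else 0) := by
        intro c
        by_cases hcb : c ≠ revIdx b
        · rw [if_pos hcb, hE a b c hab hcb]
          by_cases hca : c = revIdx a
          · rw [if_pos hca, if_pos hca, if_neg (by rw [hca]; exact hab''), if_neg (fun h => h.2.1 hca), add_zero, add_zero]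
          · rw [if_neg hca, if_neg hca, zero_add]
            by_cases hcb2 : c = b
            · rw [if_pos hcb2, if_pos hcb2, if_neg (fun h => h.2.2 hcb2), add_zero]
            · rw [if_neg hcb2, if_neg hcb2, if_pos ⟨hcb, hca, hcb2⟩, zero_add]
        · have hc : c = revIdx b := not_not.1 hcb
          rw [if_neg hcb, if_neg (by rw [hc]; exact hab'), if_neg (by rw [hc]; exact hbb), if_neg (fun h => hcb h.1)]
      rw [Finset.sum_congr rfl fun c _ => step c, Finset.sum_add_distrib, Finset.sum_add_distrib,
        Finset.sum_ite_eq' Finset.univ (revIdx a), if_pos (Finset.mem_univ _), Finset.sum_ite_eq' Finset.univ b, if_pos (Finset.mem_univ _),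
        sum_ite_const_nat, card_filter_ne_three_idx d hab' hbb hab'']
  -- level `b`
  have hB : ∀ a : Idx d, (Finset.univ.filter fun t : Idx d × Idx d × Idx d × Idx d => t.1 ≠ revIdx a ∧ (t.2.1 ≠ revIdx t.1 ∧
      (¬ (t.2.1 = revIdx a ∧ t.2.2.1 = revIdx t.1) ∧ (t.2.2.2 ≠ revIdx t.2.2.1 ∧ ¬ (t.2.2.1 = revIdx t.1 ∧ t.2.2.2 = revIdx t.2.1) ∧
        ¬ (t.2.2.2 = revIdx t.1 ∧ t.2.2.1 = revIdx t.2.1))))).card =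
      (((2 * d - 2) + (2 * d - 1) * (2 * d - 1)) + (2 * d - 2) * (2 * (2 * d - 2) + (2 * d - 2) * (2 * d - 1))) +
        (2 * d - 2) * (((2 * d - 2) + (2 * d - 2) * (2 * d - 1)) + ((2 * d - 2) + (2 * d - 1) * (2 * d - 1)) +
          (2 * d - 3) * (2 * (2 * d - 2) + (2 * d - 2) * (2 * d - 1))) := by
    intro a
    rw [card_filter_univ_prod]
    simp only [card_filter_const_and]
    have haa : a ≠ revIdx a := (revIdx_ne_self a).symm
    have step : ∀ b : Idx d, (if b ≠ revIdx a then (Finset.univ.filter fun t : Idx d × Idx d × Idx d => t.1 ≠ revIdx b ∧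
        (¬ (t.1 = revIdx a ∧ t.2.1 = revIdx b) ∧ (t.2.2 ≠ revIdx t.2.1 ∧ ¬ (t.2.1 = revIdx b ∧ t.2.2 = revIdx t.1) ∧
          ¬ (t.2.2 = revIdx b ∧ t.2.1 = revIdx t.1)))).card else 0) =
        (if b = a then ((2 * d - 2) + (2 * d - 1) * (2 * d - 1)) + (2 * d - 2) * (2 * (2 * d - 2) + (2 * d - 2) * (2 * d - 1)) else 0) +
          (if (b ≠ revIdx a ∧ b ≠ a) then ((2 * d - 2) + (2 * d - 2) * (2 * d - 1)) + ((2 * d - 2) + (2 * d - 1) * (2 * d - 1)) +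
            (2 * d - 3) * (2 * (2 * d - 2) + (2 * d - 2) * (2 * d - 1)) else 0) := by
      intro b
      by_cases hba : b ≠ revIdx a
      · rw [if_pos hba, hC a b hba]
        by_cases hba2 : b = a
        · rw [if_pos hba2, if_pos hba2, if_neg (fun h => h.2 hba2), add_zero]
        · rw [if_neg hba2, if_neg hba2, if_pos ⟨hba, hba2⟩, zero_add]
      · rw [if_neg hba, if_neg (fun h => hba (by rw [h]; exact haa)), if_neg (fun h => hba h.1)]
    rw [Finset.sum_congr rfl fun b _ => step b, Finset.sum_add_distrib, Finset.sum_ite_eq' Finset.univ a, if_pos (Finset.mem_univ _),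
      sum_ite_const_nat, card_filter_ne_ne_idx d haa.symm]
  rw [admSig_C_eq, card_filter_univ_prod]
  simp only [hB]
  rw [Finset.sum_const, smul_eq_mul, hU]

/-- Class `E` unfolded: `b ≠ −a`, `e ≠ −c`, the two admissible cancellations of `a+b+c+e` and of `b+c+e+f` excluded (`c` free with
respect to `b`, `f` free with respect to `e`). [cite: MadrasSlade1993, §4.2, remark after Theorem 4.2.4 (p. 94)] -/
theorem admSig_E_eq : admSig d sigE = Finset.univ.filter fun t : Idx5 d => t.2.1 ≠ revIdx t.1 ∧
    ((t.2.2.2.1 ≠ revIdx t.2.2.1 ∧ ¬ (t.2.2.1 = revIdx t.1 ∧ t.2.2.2.1 = revIdx t.2.1) ∧ ¬ (t.2.2.2.1 = revIdx t.1 ∧ t.2.2.1 = revIdx t.2.1)) ∧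
      (¬ (t.2.2.1 = revIdx t.2.1 ∧ t.2.2.2.2 = revIdx t.2.2.2.1) ∧ ¬ (t.2.2.2.1 = revIdx t.2.1 ∧ t.2.2.2.2 = revIdx t.2.2.1))) := by
  ext ⟨a, b, c, e, f⟩
  rw [mem_admSig_iff, Finset.mem_filter]
  simp only [sigE, GoodSig, true_implies, Bool.false_eq_true, false_implies, true_and, Finset.mem_univ]
  constructor
  · rintro ⟨h1, h3, h5, h6⟩
    refine ⟨h1, ⟨h3, ?_, ?_⟩, ?_, ?_⟩
    · rintro ⟨hca, heb⟩; apply h5; rw [hca, heb, twoStepV_revIdx, twoStepV_revIdx]; abel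
    · rintro ⟨hea, hcb⟩; apply h5; rw [hea, hcb, twoStepV_revIdx, twoStepV_revIdx]; abel
    · rintro ⟨hcb, hfe⟩; apply h6; rw [hcb, hfe, twoStepV_revIdx, twoStepV_revIdx]; abel
    · rintro ⟨heb, hfc⟩; apply h6; rw [heb, hfc, twoStepV_revIdx, twoStepV_revIdx]; abel
  · rintro ⟨h1, ⟨h3, h5, h5'⟩, h6, h6'⟩
    refine ⟨h1, h3, fun hs => ?_, fun hs => ?_⟩
    · rcases (sum_four_eq_zero_iff d a b c e).1 hs with ⟨hba, -⟩ | ⟨hca, heb⟩ | ⟨hea, hcb⟩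
      · exact h1 hba
      · exact h5 ⟨hca, heb⟩
      · exact h5' ⟨hea, hcb⟩
    · rcases (sum_four_eq_zero_iff d b c e f).1 hs with ⟨hcb, hfe⟩ | ⟨heb, hfc⟩ | ⟨-, hec⟩
      · exact h6 ⟨hcb, hfe⟩
      · exact h6' ⟨heb, hfc⟩
      · exact h3 hec

/-- `#E = 2d·(T₌ + (2d−2)·T_≠)` by iterated counting (`c` runs over all `2d` letters here). [cite: MadrasSlade1993, §4.2, remark after Theorem 4.2.4 (p. 94)] -/
theorem card_admSig_E : (admSig d sigE).card = 2 * d * (((2 * d - 2) * (2 * d - 1) + (2 * d - 1) * (2 * d) + (2 * d - 2) * ((2 * d - 1) + (2 * d - 2) * (2 * d))) + (2 * d - 2) * ((2 * d - 2) * (2 * d - 1) + (2 * d - 2) * (2 * d) + (2 * d - 1) * (2 * d) + (2 * d - 3) * ((2 * d - 1) + (2 * d - 2) * (2 * d)))) := by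
  classical
  have hU : (Finset.univ : Finset (Idx d)).card = 2 * d := by rw [Finset.card_univ, card_idx]
  -- level `f`
  have hF : ∀ b c e : Idx d, (Finset.univ.filter fun f : Idx d => ¬ (c = revIdx b ∧ f = revIdx e) ∧ ¬ (e = revIdx b ∧ f = revIdx c)).card =
      if (c = revIdx b ∨ e = revIdx b) then 2 * d - 1 else 2 * d := by
    intro b c e
    by_cases hcb : c = revIdx b
    · rw [if_pos (Or.inl hcb)]
      by_cases heb : e = revIdx b
      · have hce : revIdx c = revIdx e := by rw [hcb, heb]
        rw [Finset.filter_congr (q := fun f : Idx d => f ≠ revIdx e) fun f _ => by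
          constructor
          · rintro ⟨h1, -⟩; exact fun hf => h1 ⟨hcb, hf⟩
          · intro h1; exact ⟨fun hh => h1 hh.2, fun hh => h1 (by rw [← hce]; exact hh.2)⟩]
        exact card_filter_ne_idx d (revIdx e)
      · rw [Finset.filter_congr (q := fun f : Idx d => f ≠ revIdx e) fun f _ => by
          constructor
          · rintro ⟨h1, -⟩; exact fun hf => h1 ⟨hcb, hf⟩
          · intro h1; exact ⟨fun hh => h1 hh.2, fun hh => heb hh.1⟩]
        exact card_filter_ne_idx d (revIdx e)
    · by_cases heb : e = revIdx b
      · rw [if_pos (Or.inr heb), Finset.filter_congr (q := fun f : Idx d => f ≠ revIdx c) fun f _ => by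
          constructor
          · rintro ⟨-, h2⟩; exact fun hf => h2 ⟨heb, hf⟩
          · intro h2; exact ⟨fun hh => hcb hh.1, fun hh => h2 hh.2⟩]
        exact card_filter_ne_idx d (revIdx c)
      · rw [if_neg (not_or.2 ⟨hcb, heb⟩), Finset.filter_eq_self.2 (fun f _ => ⟨fun hh => hcb hh.1, fun hh => heb hh.1⟩), hU]
  -- level `e`
  have hE : ∀ a b c : Idx d, b ≠ revIdx a →
      (Finset.univ.filter fun t : Idx d × Idx d => (t.1 ≠ revIdx c ∧ ¬ (c = revIdx a ∧ t.1 = revIdx b) ∧ ¬ (t.1 = revIdx a ∧ c = revIdx b)) ∧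
        (¬ (c = revIdx b ∧ t.2 = revIdx t.1) ∧ ¬ (t.1 = revIdx b ∧ t.2 = revIdx c))).card =
        if c = revIdx b then (2 * d - 2) * (2 * d - 1) else if c = revIdx a then (2 * d - 2) * (2 * d) else if c = b then (2 * d - 1) * (2 * d) else ((2 * d - 1) + (2 * d - 2) * (2 * d)) := by
    intro a b c hab
    rw [card_filter_univ_prod]
    simp only [card_filter_const_and]
    by_cases hcb : c = revIdx b
    · rw [if_pos hcb]
      have hcr : revIdx c = b := by rw [hcb, revIdx_revIdx]
      -- the admissible `e` avoid `b` and `revIdx a` (when `a = b` the second square condition supplies `e ≠ revIdx b` instead)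
      have step : ∀ e : Idx d, (if (e ≠ revIdx c ∧ ¬ (c = revIdx a ∧ e = revIdx b) ∧ ¬ (e = revIdx a ∧ c = revIdx b)) then
          (Finset.univ.filter fun f : Idx d => ¬ (c = revIdx b ∧ f = revIdx e) ∧ ¬ (e = revIdx b ∧ f = revIdx c)).card else 0) =
          if (e ≠ b ∧ e ≠ revIdx a) then 2 * d - 1 else 0 := by
        intro e
        rw [hF b c e, if_pos (Or.inl hcb)]
        by_cases h : (e ≠ b ∧ e ≠ revIdx a)
        · rw [if_pos h, if_pos]
          refine ⟨by rw [hcr]; exact h.1, fun hh => ?_, fun hh => h.2 hh.1⟩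
          have hba : b = a := revIdx_inj (hcb.symm.trans hh.1)
          exact h.2 (by rw [← hba]; exact hh.2)
        · rw [if_neg h, if_neg]
          rintro ⟨h1, -, h3⟩
          exact h ⟨by rw [← hcr]; exact h1, fun hh => h3 ⟨hh, hcb⟩⟩
      rw [Finset.sum_congr rfl fun e _ => step e, sum_ite_const_nat, card_filter_ne_ne_idx d hab]
    · rw [if_neg hcb]
      have step0 : ∀ e : Idx d, (if (e ≠ revIdx c ∧ ¬ (c = revIdx a ∧ e = revIdx b) ∧ ¬ (e = revIdx a ∧ c = revIdx b)) then
          (Finset.univ.filter fun f : Idx d => ¬ (c = revIdx b ∧ f = revIdx e) ∧ ¬ (e = revIdx b ∧ f = revIdx c)).card else 0) =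
          if (e ≠ revIdx c ∧ ¬ (c = revIdx a ∧ e = revIdx b)) then (if e = revIdx b then 2 * d - 1 else 2 * d) else 0 := by
        intro e
        rw [hF b c e]
        by_cases h : (e ≠ revIdx c ∧ ¬ (c = revIdx a ∧ e = revIdx b))
        · rw [if_pos ⟨h.1, h.2, fun hh => hcb hh.2⟩, if_pos h]
          by_cases heb : e = revIdx b
          · rw [if_pos (Or.inr heb), if_pos heb]
          · rw [if_neg (not_or.2 ⟨hcb, heb⟩), if_neg heb]
        · rw [if_neg (fun hh => h ⟨hh.1, hh.2.1⟩), if_neg h]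
      rw [Finset.sum_congr rfl fun e _ => step0 e]
      by_cases hca : c = revIdx a
      · rw [if_pos hca]
        have hcb' : revIdx c ≠ revIdx b := by rw [hca, revIdx_revIdx]; exact ne_revIdx_symm hab
        have step : ∀ e : Idx d, (if (e ≠ revIdx c ∧ ¬ (c = revIdx a ∧ e = revIdx b)) then (if e = revIdx b then 2 * d - 1 else 2 * d) else 0) =
            if (e ≠ revIdx c ∧ e ≠ revIdx b) then 2 * d else 0 := by
          intro e
          by_cases h : (e ≠ revIdx c ∧ e ≠ revIdx b)
          · rw [if_pos h, if_pos ⟨h.1, fun hh => h.2 hh.2⟩, if_neg h.2]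
          · rw [if_neg h, if_neg (fun h' => h ⟨h'.1, fun hh => h'.2 ⟨hca, hh⟩⟩)]
        rw [Finset.sum_congr rfl fun e _ => step e, sum_ite_const_nat, card_filter_ne_ne_idx d hcb']
      · rw [if_neg hca]
        by_cases hcb2 : c = b
        · rw [if_pos hcb2]
          have step : ∀ e : Idx d, (if (e ≠ revIdx c ∧ ¬ (c = revIdx a ∧ e = revIdx b)) then (if e = revIdx b then 2 * d - 1 else 2 * d) else 0) =
              if e ≠ revIdx c then 2 * d else 0 := by
            intro e
            by_cases h : e ≠ revIdx c
            · rw [if_pos h, if_pos ⟨h, fun hh => hca hh.1⟩, if_neg (by rw [← hcb2]; exact h)]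
            · rw [if_neg h, if_neg (fun h' => h h'.1)]
          rw [Finset.sum_congr rfl fun e _ => step e, sum_ite_const_nat, card_filter_ne_idx]
        · rw [if_neg hcb2]
          have hbc' : revIdx b ≠ revIdx c := fun h => hcb2 (revIdx_inj h).symm
          have step : ∀ e : Idx d, (if (e ≠ revIdx c ∧ ¬ (c = revIdx a ∧ e = revIdx b)) then (if e = revIdx b then 2 * d - 1 else 2 * d) else 0) =
              (if e = revIdx b then 2 * d - 1 else 0) + (if (e ≠ revIdx c ∧ e ≠ revIdx b) then 2 * d else 0) := by
            intro e
            by_cases heb : e = revIdx b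
            · rw [if_pos ⟨by rw [heb]; exact hbc', fun hh => hca hh.1⟩, if_pos heb, if_pos heb, if_neg (fun h => h.2 heb), add_zero]
            · rw [if_neg heb, if_neg heb, zero_add]
              by_cases hec : e ≠ revIdx c
              · rw [if_pos ⟨hec, fun hh => hca hh.1⟩, if_pos ⟨hec, heb⟩]
              · rw [if_neg (fun h => hec h.1), if_neg (fun h => hec h.1)]
          rw [Finset.sum_congr rfl fun e _ => step e, Finset.sum_add_distrib, Finset.sum_ite_eq' Finset.univ (revIdx b),
            if_pos (Finset.mem_univ _), sum_ite_const_nat, card_filter_ne_ne_idx d hbc'.symm]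
  -- level `c` (no constraint on `c` itself)
  have hC : ∀ a b : Idx d, b ≠ revIdx a →
      (Finset.univ.filter fun t : Idx d × Idx d × Idx d =>
        (t.2.1 ≠ revIdx t.1 ∧ ¬ (t.1 = revIdx a ∧ t.2.1 = revIdx b) ∧ ¬ (t.2.1 = revIdx a ∧ t.1 = revIdx b)) ∧
        (¬ (t.1 = revIdx b ∧ t.2.2 = revIdx t.2.1) ∧ ¬ (t.2.1 = revIdx b ∧ t.2.2 = revIdx t.1))).card =
        if b = a then ((2 * d - 2) * (2 * d - 1) + (2 * d - 1) * (2 * d) + (2 * d - 2) * ((2 * d - 1) + (2 * d - 2) * (2 * d))) else ((2 * d - 2) * (2 * d - 1) + (2 * d - 2) * (2 * d) + (2 * d - 1) * (2 * d) + (2 * d - 3) * ((2 * d - 1) + (2 * d - 2) * (2 * d))) := by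
    intro a b hab
    rw [card_filter_univ_prod]
    simp only [hE a b _ hab]
    have hbb : revIdx b ≠ b := revIdx_ne_self b
    have hab'' : revIdx a ≠ b := fun h => hab h.symm
    by_cases hba : b = a
    · rw [if_pos hba]
      have step : ∀ c : Idx d, (if c = revIdx b then (2 * d - 2) * (2 * d - 1) else if c = revIdx a then (2 * d - 2) * (2 * d) else if c = b then (2 * d - 1) * (2 * d) else ((2 * d - 1) + (2 * d - 2) * (2 * d))) =
          (if c = revIdx b then (2 * d - 2) * (2 * d - 1) else 0) + (if c = b then (2 * d - 1) * (2 * d) else 0) + (if (c ≠ revIdx b ∧ c ≠ b) then ((2 * d - 1) + (2 * d - 2) * (2 * d)) else 0) := by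
        intro c
        by_cases hcb : c = revIdx b
        · rw [if_pos hcb, if_pos hcb, if_neg (by rw [hcb]; exact hbb), if_neg (fun h => h.1 hcb), add_zero, add_zero]
        · have hca : c ≠ revIdx a := by rw [← hba]; exact hcb
          rw [if_neg hcb, if_neg hca, if_neg hcb, zero_add]
          by_cases hcb2 : c = b
          · rw [if_pos hcb2, if_pos hcb2, if_neg (fun h => h.2 hcb2), add_zero]
          · rw [if_neg hcb2, if_neg hcb2, if_pos ⟨hcb, hcb2⟩, zero_add]
      rw [Finset.sum_congr rfl fun c _ => step c, Finset.sum_add_distrib, Finset.sum_add_distrib,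
        Finset.sum_ite_eq' Finset.univ (revIdx b), if_pos (Finset.mem_univ _), Finset.sum_ite_eq' Finset.univ b, if_pos (Finset.mem_univ _),
        sum_ite_const_nat, card_filter_ne_ne_idx d hbb]
    · rw [if_neg hba]
      have hab' : revIdx b ≠ revIdx a := fun h => hba (revIdx_inj h)
      have step : ∀ c : Idx d, (if c = revIdx b then (2 * d - 2) * (2 * d - 1) else if c = revIdx a then (2 * d - 2) * (2 * d) else if c = b then (2 * d - 1) * (2 * d) else ((2 * d - 1) + (2 * d - 2) * (2 * d))) =
          (if c = revIdx b then (2 * d - 2) * (2 * d - 1) else 0) + (if c = revIdx a then (2 * d - 2) * (2 * d) else 0) + (if c = b then (2 * d - 1) * (2 * d) else 0) +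
            (if (c ≠ revIdx b ∧ c ≠ revIdx a ∧ c ≠ b) then ((2 * d - 1) + (2 * d - 2) * (2 * d)) else 0) := by
        intro c
        by_cases hcb : c = revIdx b
        · rw [if_pos hcb, if_pos hcb, if_neg (by rw [hcb]; exact hab'), if_neg (by rw [hcb]; exact hbb), if_neg (fun h => h.1 hcb),
            add_zero, add_zero, add_zero]
        · rw [if_neg hcb, if_neg hcb, zero_add]
          by_cases hca : c = revIdx a
          · rw [if_pos hca, if_pos hca, if_neg (by rw [hca]; exact hab''), if_neg (fun h => h.2.1 hca), add_zero, add_zero]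
          · rw [if_neg hca, if_neg hca, zero_add]
            by_cases hcb2 : c = b
            · rw [if_pos hcb2, if_pos hcb2, if_neg (fun h => h.2.2 hcb2), add_zero]
            · rw [if_neg hcb2, if_neg hcb2, if_pos ⟨hcb, hca, hcb2⟩, zero_add]
      rw [Finset.sum_congr rfl fun c _ => step c, Finset.sum_add_distrib, Finset.sum_add_distrib, Finset.sum_add_distrib,
        Finset.sum_ite_eq' Finset.univ (revIdx b), if_pos (Finset.mem_univ _), Finset.sum_ite_eq' Finset.univ (revIdx a),
        if_pos (Finset.mem_univ _), Finset.sum_ite_eq' Finset.univ b, if_pos (Finset.mem_univ _), sum_ite_const_nat,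
        card_filter_ne_three_idx d hab' hbb hab'']
  -- level `b`
  have hB : ∀ a : Idx d, (Finset.univ.filter fun t : Idx d × Idx d × Idx d × Idx d => t.1 ≠ revIdx a ∧
      ((t.2.2.1 ≠ revIdx t.2.1 ∧ ¬ (t.2.1 = revIdx a ∧ t.2.2.1 = revIdx t.1) ∧ ¬ (t.2.2.1 = revIdx a ∧ t.2.1 = revIdx t.1)) ∧
        (¬ (t.2.1 = revIdx t.1 ∧ t.2.2.2 = revIdx t.2.2.1) ∧ ¬ (t.2.2.1 = revIdx t.1 ∧ t.2.2.2 = revIdx t.2.1)))).card =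
      ((2 * d - 2) * (2 * d - 1) + (2 * d - 1) * (2 * d) + (2 * d - 2) * ((2 * d - 1) + (2 * d - 2) * (2 * d))) + (2 * d - 2) * ((2 * d - 2) * (2 * d - 1) + (2 * d - 2) * (2 * d) + (2 * d - 1) * (2 * d) + (2 * d - 3) * ((2 * d - 1) + (2 * d - 2) * (2 * d))) := by
    intro a
    rw [card_filter_univ_prod]
    simp only [card_filter_const_and]
    have haa : a ≠ revIdx a := (revIdx_ne_self a).symm
    have step : ∀ b : Idx d, (if b ≠ revIdx a then (Finset.univ.filter fun t : Idx d × Idx d × Idx d =>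
        (t.2.1 ≠ revIdx t.1 ∧ ¬ (t.1 = revIdx a ∧ t.2.1 = revIdx b) ∧ ¬ (t.2.1 = revIdx a ∧ t.1 = revIdx b)) ∧
        (¬ (t.1 = revIdx b ∧ t.2.2 = revIdx t.2.1) ∧ ¬ (t.2.1 = revIdx b ∧ t.2.2 = revIdx t.1))).card else 0) =
        (if b = a then ((2 * d - 2) * (2 * d - 1) + (2 * d - 1) * (2 * d) + (2 * d - 2) * ((2 * d - 1) + (2 * d - 2) * (2 * d))) else 0) + (if (b ≠ revIdx a ∧ b ≠ a) then ((2 * d - 2) * (2 * d - 1) + (2 * d - 2) * (2 * d) + (2 * d - 1) * (2 * d) + (2 * d - 3) * ((2 * d - 1) + (2 * d - 2) * (2 * d))) else 0) := by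
      intro b
      by_cases hba : b ≠ revIdx a
      · rw [if_pos hba, hC a b hba]
        by_cases hba2 : b = a
        · rw [if_pos hba2, if_pos hba2, if_neg (fun h => h.2 hba2), add_zero]
        · rw [if_neg hba2, if_neg hba2, if_pos ⟨hba, hba2⟩, zero_add]
      · rw [if_neg hba, if_neg (fun h => hba (by rw [h]; exact haa)), if_neg (fun h => hba h.1)]
    rw [Finset.sum_congr rfl fun b _ => step b, Finset.sum_add_distrib, Finset.sum_ite_eq' Finset.univ a, if_pos (Finset.mem_univ _),
      sum_ite_const_nat, card_filter_ne_ne_idx d haa.symm]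
  rw [admSig_E_eq, card_filter_univ_prod]
  simp only [hB]
  rw [Finset.sum_const, smul_eq_mul, hU]

end fibres


/-! ### The mirror classes: reversing the word -/

section mirror

variable (d : ℕ)

/-- Reversal of a five-letter word. [cite: MadrasSlade1993, Definition 1.2.4] -/
def rev5 (u : Idx5 d) : Idx5 d := (u.2.2.2.2, u.2.2.2.1, u.2.2.1, u.2.1, u.1)

/-- The mirror of a signature: `(0,2) ↔ (3,5)`, `(1,3) ↔ (2,4)`, `(0,4) ↔ (1,5)`. [cite: MadrasSlade1993, §4.2, remark after Theorem 4.2.4 (p. 94)] -/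
def mirror (σ : Bool × Bool × Bool × Bool × Bool × Bool) : Bool × Bool × Bool × Bool × Bool × Bool :=
  (σ.2.2.2.1, σ.2.2.1, σ.2.1, σ.1, σ.2.2.2.2.2, σ.2.2.2.2.1)

/-- `rev5` is an involution. [cite: MadrasSlade1993, Definition 1.2.4] -/
theorem rev5_rev5 (u : Idx5 d) : rev5 d (rev5 d u) = u := by
  obtain ⟨a, b, c, e, f⟩ := u; rfl

/-- `rev5` is injective. [cite: MadrasSlade1993, Definition 1.2.4] -/
theorem rev5_injective : Function.Injective (rev5 d) := by
  intro u w h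
  have h' := congrArg (rev5 d) h
  rwa [rev5_rev5, rev5_rev5] at h'

/-- The block condition of `σ` on the reversed word is the block condition of the mirror signature. [cite: MadrasSlade1993, §4.2, remark after Theorem 4.2.4 (p. 94)] -/
theorem goodSig_rev5 (σ : Bool × Bool × Bool × Bool × Bool × Bool) (u : Idx5 d) : GoodSig d σ (rev5 d u) ↔ GoodSig d (mirror σ) u := by
  obtain ⟨a, b, c, e, f⟩ := u
  obtain ⟨s1, s2, s3, s4, s5, s6⟩ := σ
  simp only [GoodSig, rev5, mirror]
  constructor
  · rintro ⟨h1, h2, h3, h4, h5, h6⟩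
    refine ⟨fun x => ne_revIdx_symm (h4 x), fun x => ne_revIdx_symm (h3 x), fun x => ne_revIdx_symm (h2 x),
      fun x => ne_revIdx_symm (h1 x), fun x hs => h6 x ?_, fun x hs => h5 x ?_⟩
    · rw [← hs]; abel
    · rw [← hs]; abel
  · rintro ⟨h1, h2, h3, h4, h5, h6⟩
    refine ⟨fun x => ne_revIdx_symm (h4 x), fun x => ne_revIdx_symm (h3 x), fun x => ne_revIdx_symm (h2 x),
      fun x => ne_revIdx_symm (h1 x), fun x hs => h6 x ?_, fun x hs => h5 x ?_⟩
    · rw [← hs]; abel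
    · rw [← hs]; abel

/-- ★ Mirror classes have the same size. [cite: MadrasSlade1993, §4.2, remark after Theorem 4.2.4 (p. 94)] -/
theorem card_admSig_mirror (σ : Bool × Bool × Bool × Bool × Bool × Bool) : (admSig d (mirror σ)).card = (admSig d σ).card := by
  have heq : admSig d (mirror σ) = (admSig d σ).image (rev5 d) := by
    ext u
    rw [mem_admSig_iff, Finset.mem_image]
    constructor
    · intro h
      exact ⟨rev5 d u, (mem_admSig_iff d).2 ((goodSig_rev5 d σ u).2 h), rev5_rev5 d u⟩
    · rintro ⟨w, hw, rfl⟩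
      have hw' := (mem_admSig_iff d).1 hw
      rw [← rev5_rev5 d w] at hw'
      exact (goodSig_rev5 d σ (rev5 d w)).1 hw'
  rw [heq, Finset.card_image_of_injective _ (rev5_injective d)]

end mirror

/-! ### The count -/

/-- ★★ **`N_{7,9}(ℤ^{d+1}) + 1088d⁴ + 196d = 640d⁵ + 320d³ + 376d²`** (subtraction-free closed form of the three-slack layer at span
two: twenty height words, five fibre classes). [cite: MadrasSlade1993, §4.2, remark after Theorem 4.2.4 (p. 94)] -/
theorem costCoeffZd_seven_nine_add (d : ℕ) : costCoeffZd d 7 9 + 1088 * d ^ 4 + 196 * d = 640 * d ^ 5 + 320 * d ^ 3 + 376 * d ^ 2 := by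
  have h := costCoeffZd_seven_nine_eq_sum d
  rw [sum_card_adm] at h
  have hA := card_admSig_A_add d
  have hG := card_admSig_D_add d
  have hB := card_admSig_B d
  have hC := card_admSig_C d
  have hE := card_admSig_E d
  have hB' : (admSig d sigB').card = (admSig d sigB).card := card_admSig_mirror d sigB
  have hC' : (admSig d sigC').card = (admSig d sigC).card := card_admSig_mirror d sigC
  have hD' : (admSig d sigD').card = (admSig d sigD).card := card_admSig_mirror d sigD
  have hE' : (admSig d sigE').card = (admSig d sigE).card := card_admSig_mirror d sigE
  rw [hB', hC', hD', hE'] at h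
  -- keep the census and the class sizes opaque
  generalize costCoeffZd d 7 9 = N at h ⊢
  generalize (admSig d sigA).card = A at h hA
  generalize (admSig d sigB).card = B at h hB
  generalize (admSig d sigC).card = C at h hC
  generalize (admSig d sigD).card = G at h hG
  generalize (admSig d sigE).card = E at h hE
  rcases Nat.lt_or_ge d 2 with hd | hd
  · interval_cases d
    · norm_num at h hA hB hC hG hE ⊢; omega
    · norm_num at h hA hB hC hG hE ⊢; omega
  · obtain ⟨k, rfl⟩ := Nat.exists_eq_add_of_le hd
    have e1 : 2 * (2 + k) - 1 = 2 * k + 3 := by omega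
    have e2 : 2 * (2 + k) - 2 = 2 * k + 2 := by omega
    have e3 : 2 * (2 + k) - 3 = 2 * k + 1 := by omega
    have e4 : 4 * (2 + k) - 3 = 4 * k + 5 := by omega
    rw [e1, e2, e4] at hA
    rw [e1, e2] at hG
    rw [e1, e2, e3] at hB hC hE
    linear_combination h + 8 * hA + 2 * hG + 4 * hB + 4 * hC + 2 * hE

/-- ★★ **`N_{7,9}(ℤ^{d+1}) = 640d⁵ − 1088d⁴ + 320d³ + 376d² − 196d`** — the three-slack layer of the pulled large-force expansion at span
two (`d = 1, …, 6`: `52`, `6 744`, `78 828`, `402 544`, `1 368 420`, `3 648 072`; the positive terms are grouped first so that truncated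
subtraction in `ℕ` is harmless). This is the `A = 2` instance of the lane's three-slack law; not in print.
[cite: MadrasSlade1993, §4.2, remark after Theorem 4.2.4 (p. 94)] -/
theorem costCoeffZd_seven_nine (d : ℕ) : costCoeffZd d 7 9 = 640 * d ^ 5 + 320 * d ^ 3 + 376 * d ^ 2 - 1088 * d ^ 4 - 196 * d := by
  have h := costCoeffZd_seven_nine_add d
  omega

end ThreeSlackTwo

end Literature.Probability.RandomPlanarGeometry.SAW.Zd

end
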